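import Summits.AnomalousDissipation.AnomalousDissipation.Theorems.CubicParityLoud.Negative.MeanFlow
import Summits.AnomalousDissipation.AnomalousDissipation.Theorems.MomentParityCubicParityLoudFarkas
import Summits.AnomalousDissipation.AnomalousDissipation.Theorems.MomentParityCubicParityLoudCubicCasimir
import Summits.AnomalousDissipation.AnomalousDissipation.Theorems.MomentParityCubicParityLoudNoCasimirCertificate
import Summits.AnomalousDissipation.AnomalousDissipation.Theorems.MomentParityCubicParityLoudDiagonalClassification
import Summits.AnomalousDissipation.AnomalousDissipation.Theorems.MomentParityCubicParityLoudBalancedMenu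
import Literature.Analysis.FluidPDE.NSGalerkinFourier
import Literature.Analysis.FluidPDE.BeltramiWavesCurl
import Summits.AnomalousDissipation.AnomalousDissipation.Theses.QuarticLadder

/-!
# Line `rim-split-sweep` for crux `CubicParityLoud` (stmt-AnomalousDissipation-11465; routes QuarticLadder r5 / MomentParity)
# — strategist line (planner-cstrat-stmt-AnomalousDissipation-11465-b1-0, 2026-08-17)

A NEW LINE ONLY WHERE THE PICKED LINE IS STILL OPEN.  Base: the lead's reshaped skeleton
`Cruxes/CubicParityLoud/Lines/farkas_split_menu.lean` (lead `prover-line-stmt-AnomalousDissipation-11465-0`,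
sha b194971b6fa0, 2026-08-16T08:40Z), of whose seven stubs FIVE ARE LANDED THEOREMS (S1 `stub_farkas`,
S2 `stub_cubicCasimir`, S3b `stub_diagonalClassification`, S4 `stub_noCasimirCertificate`, S5 `stub_balancedMenu`,
all under `Theorems/MomentParityCubicParityLoud*.lean`, imported below and used BY NAME) and four remain registered and
open: `stub_isotypeDecoupling` (S3a-i, M), `stub_killRules` (S3a-ii, L), `stub_covariantClosure` (S3a-iii, L: the
all-`N ≥ 3` combinatorial sweep of the kill rules), `stub_coefficientBridge` (S3c, M–L).  This file keeps the first,
second and fourth VERBATIM (same names, same signatures — their registrations stay intact) and REPLACES THE THIRD BY A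
THEOREM: the piece that carried the residual all-`N` risk named by drefute ("an all-N combinatorial argument that the
local identities reach every block; nothing cheap bites") is PROVED here in its eventual form (v3, 2026-08-17):

## The lever: the sweep only has to hold EVENTUALLY in `N`, and then it is METRIC, not combinatorial

`covariantVanishing` (hence `CubicParityLoud_of`, threshold `max N₀(ν) N₁`) consumes the sweep only through
`∃ N₁, ∀ N ≥ N₁`.  With the threshold free, the sweep splits into two regimes by the size of the defect `d`
relative to the ball, each closed by ONE uniform argument:

* **Large defects `3|d|² ≥ N²` — the RIM SPLIT (`stub_rimSplit`, PROVED below).**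
  Every present block `(x, x+d)` has a representative (itself or its SYM-partner `(−x−d, −x)`) whose WINDOW
  `w = (x+d)·d` is `≥ |d|²/2 ≥ N²/6` (the two windows are integers summing to `|d|²`).  For such a block there is
  an explicit split `x = a + b`, `a ≈ x/2 + z`, `z ⊥ x, d`, `|z|² = (11/12)N² − |x|²/4`, rounded to the lattice
  (+ one unit step to separate `|a|` from `|b|`), with `|a|², |b|² ≤ N²` and `|a+d|², |b+d|² ≥ (13/12)N² − O(N) > N²`
  for `N ≥ 64`: both side blocks of the ISOLATION rule are then ABSENT and the rule kills the block outright —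
  no chains, no dependencies, no case analysis on the shape of `d`.
* **Small defects `3|d|² < N²` (so `d ∈ S`) — LADDER CHAINS (`stub_ladderChains`, PROVED below) + a GENERIC SPLIT of
  collinear blocks (`stub_collinearSplit`, PROVED below, `N ≥ 8`).**  CHAIN from both ends
  of every non-collinear ladder `x + ℤd ∩ S` kills every block but the EQUILATERAL one (`|x| = |x+d| = |d|`;
  chord lemma: two norm-`|d|` lattice points on a line of direction `d ∦ x` are consecutive, by strict
  Cauchy–Schwarz `(p·d)² < |p|²|d|²`), which ONE-SHOT kills because `|2x+d|² = 3|d|² < N²`; a collinear block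
  `x ∥ d` is killed by ISOLATION with ANY split `x = a + b` into non-parallel ball vectors of different norms,
  its side blocks `(−d−a, −a)`, `(−d−b, −b)` being non-collinear (dead) or absent.
The regime glue `covariantClosure_eventually` (threshold `64`) is a THEOREM below (non-collinear blocks first — ladder
chains / rim split + isolation with absent side blocks —, then collinear blocks by isolation at the generic split, whose
side blocks are non-collinear hence dead), fed to `covariantVanishing` in place of `stub_covariantClosure`; so on this
line the ENTIRE all-`N` combinatorial sweep of the picked line is discharged, and the lead's `stub_covariantClosure`
(`N ≥ 3`) is DROPPED from this skeleton as unnecessary work (it remains in `Lines/farkas_split_menu.lean`).  OPEN STUBS OF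
THIS LINE = exactly the lead's three: `stub_isotypeDecoupling` (M), `stub_killRules` (L, the hardest), `stub_coefficientBridge` (M–L).  Everything else — engines `localRank` / `isolationRank` (proved), S1/S2/S3b/S4/S5 (landed),
`coefficientClassification_eventually`, `quadRigidity_eventually`, the composition — is the lead's, byte for byte;
the composition is given twice, for `Theses.QuarticLadder.CubicParityLoud` (`CubicParityLoud_of`, this seat's
route) and for the defeq twin `Theses.MomentParity.CubicParityLoud` (`momentParity_cubicParityLoud_of`).

Why it dodges the open goal of the picked line: the lead's `stub_covariantClosure` asks for the closure at EVERY
`N ≥ 3` and every `d`, i.e. explicit isolation splits for the equilateral blocks with `3|d|² > N²`, for the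
collinear ladders and for `|d| > N`, each an ad-hoc lattice construction with small-`N` accidents (the `N = 2`
axis-point survivors of the closure rule, drefute §S3a); here all constructions are ONE metric recipe with slack
`≍ N²` against rounding errors `≍ N`, valid from a threshold on, and the only genuinely combinatorial statement
left (`stub_ladderChains`) needs no construction at all.  Numerics already on the item are consistent with both
regimes (lead: complete kill at `3 ≤ N ≤ 13`, closure_runs.log; drefute: covariant nullity `0` for every class at
`N ≤ 9`, kit j012825/j013392).

## Disproof.lean used (tree `Cruxes/CubicParityLoud/Disproof.lean`, §0–§11, read 2026-08-17)

NO KILL, no `-- Targets`.  As in the base skeleton: `cubicParityLoud_false_without_nonzero/_divFree/_zeroMean`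
are honoured in S5 only (landed `stub_balancedMenu`: forced mode `p₀`); `not_cubicParityLoudUniformLevel`
(threshold `max N₀(ν) N₁` chosen after `ν`; the new `N₁ = 64 ∨ 3` is `ν`-free and harmless),
`not_cubicParityLoudUniformInForce`, `not_cubicParityLoudAllViscosities` (constants from S5); the §11 FLUX FLOOR
concerns witnesses, not the force-free classification stubs touched here.  No stub instantiates a refuted
`CubicParityLoud*` strengthening: the three new stubs are statements about `ℤ³` only.
-/

noncomputable section

namespace Summit.AnomalousDissipation.AnomalousDissipation.Cruxes.CubicParityLoud.RimSplitSweep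

open MeasureTheory Filter UnitAddTorus
open scoped InnerProductSpace RealInnerProductSpace ENNReal
open Literature.Analysis.FunctionSpaces Literature.Analysis.FluidPDE
open Summit.AnomalousDissipation.AnomalousDissipation.Theses.MomentParity
open Summit.AnomalousDissipation.AnomalousDissipation.Theorems.CubicParityLoud.Negative

set_option linter.dupNamespace false

/-! ## The two LOCAL ENGINE LEMMAS of the classification — proved (sorry-free, standard axioms)

Copied verbatim from `Lines/plane-wave-polarization-recursion.lean` (planner
`planner-cruxplan-stmt-AnomalousDissipation-11465-plane-wave-polarizat-0`), whose S3 is fed them as hypotheses.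

Both are pure real linear algebra in `ℝ³` (Mathlib `dotProduct` / `crossProduct`); they are the
`N`-uniform certificates of the line (card `LocalRankLemma`; triage r1-2 maps (A), (B)).  The lead
should land them first, verbatim, as `Theorems/MomentParityCubicParityLoudLocalRank.lean`
(`--supports stmt-AnomalousDissipation-11465`); the prover of `stub_covariantVanishing` then cites them. -/

section Engine

open Matrix

/-- A vector orthogonal to `k`, `d` and `k × d` vanishes when `k × d ≠ 0` (Lagrange's identity
`|m × c|² = |m|²|c|² − (m·c)²` with `c = k × d`, and `m × (k × d) = (m·d)k − (m·k)d`). [folklore] -/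
theorem eq_zero_of_perp (k d m : Fin 3 → ℝ) (hkd : crossProduct k d ≠ 0)
    (hk : dotProduct m k = 0) (hd : dotProduct m d = 0) (hc : dotProduct m (crossProduct k d) = 0) :
    m = 0 := by
  have hcc : dotProduct (crossProduct k d) (crossProduct k d) ≠ 0 :=
    fun h0 => hkd (dotProduct_self_eq_zero.1 h0)
  have hcross : crossProduct m (crossProduct k d) = 0 := by
    rw [cross_cross_eq_smul_sub_smul', hd, dotProduct_comm, hk, zero_smul, zero_smul, sub_zero]
  have hlag := cross_dot_cross m (crossProduct k d) m (crossProduct k d)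
  rw [hcross, dotProduct_zero, hc, zero_mul, sub_zero] at hlag
  exact dotProduct_self_eq_zero.1 ((mul_eq_zero.1 hlag.symm).resolve_right hcc)

/-- Reciprocal-basis expansion in `ℝ³`:
`(u·(v×w)) x = (x·(v×w)) u + (x·(w×u)) v + (x·(u×v)) w`. [folklore] -/
theorem triple_decomp (u v w x : Fin 3 → ℝ) :
    (dotProduct u (crossProduct v w)) • x =
      (dotProduct x (crossProduct v w)) • u + (dotProduct x (crossProduct w u)) • v +
        (dotProduct x (crossProduct u v)) • w := by
  simp_rw [cross_apply, vec3_dotProduct]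
  ext i
  fin_cases i <;>
  · simp only [Fin.isValue, Nat.succ_eq_add_one, Nat.reduceAdd, Fin.reduceFinMk, cons_val,
      Pi.add_apply, Pi.smul_apply, smul_eq_mul, Fin.zero_eta, Fin.mk_one, cons_val_zero, cons_val_one]
    ring

/-- **THREE-WAVE (isolation-round) RANK LEMMA — proved** (triage r1-2 map (B), r1-3 merge note; was
the card's second engine).  For real frequencies `a ∦ b` with `|a|² ≠ |b|²`: a vector `n ⊥ a + b`
orthogonal to every `(x·b) y + (y·a) x` (`x ⊥ a`, `y ⊥ b`) — the symmetric convection symbol of the two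
plane waves — is zero; i.e. the block `S(a+b, ·)` of a Casimir is pinned by ONE three-mode identity once
its two side blocks are cleared.  (Kernel `ℝ(a − b)` exactly when `|a| = |b|`: the isosceles exception
of the isolation round.)  Proof: test pairs `(a×b, b×(a×b))` and `(a×(a×b), b×(a×b))` give
`n·(a×b) = 0` and `|a×b|²(|a|²−|b|²)(n·a) = 0`. [folklore] -/
theorem isolationRank (a b n : Fin 3 → ℝ) (hab : crossProduct a b ≠ 0)
    (hnorm : dotProduct a a ≠ dotProduct b b) (hn : dotProduct n (a + b) = 0)
    (h : ∀ x y : Fin 3 → ℝ, dotProduct x a = 0 → dotProduct y b = 0 →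
      dotProduct x b * dotProduct n y + dotProduct y a * dotProduct n x = 0) : n = 0 := by
  set c : Fin 3 → ℝ := crossProduct a b with hc
  have hcc : dotProduct c c ≠ 0 := fun h0 => hab (dotProduct_self_eq_zero.1 h0)
  -- orthogonality of the test vectors
  have hca : dotProduct c a = 0 := by rw [hc, dotProduct_comm]; exact dot_self_cross a b
  have hcb : dotProduct c b = 0 := by rw [hc, dotProduct_comm]; exact dot_cross_self a b
  have hxa : dotProduct (crossProduct a c) a = 0 := by rw [dotProduct_comm]; exact dot_self_cross a c
  have hyb : dotProduct (crossProduct b c) b = 0 := by rw [dotProduct_comm]; exact dot_self_cross b c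
  -- triple products against the test vectors
  have h_bca : dotProduct (crossProduct b c) a = dotProduct c c := by
    rw [dotProduct_comm, triple_product_permutation, triple_product_permutation]
  have h_acb : dotProduct (crossProduct a c) b = -dotProduct c c := by
    rw [dotProduct_comm, triple_product_permutation, triple_product_permutation, ← cross_anticomm,
      dotProduct_neg]
  -- Step 1: `n ⬝ c = 0`
  have h1 := h c (crossProduct b c) hca hyb
  rw [hcb, zero_mul, zero_add, h_bca] at h1
  have hnc : dotProduct n c = 0 := (mul_eq_zero.1 h1).resolve_left hcc
  -- Step 2: `n ⬝ a = n ⬝ b = 0`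
  have h2 := h (crossProduct a c) (crossProduct b c) hxa hyb
  rw [h_acb, h_bca] at h2
  have hac : crossProduct a c = (dotProduct a b) • a - (dotProduct a a) • b := by
    rw [hc, cross_cross_eq_smul_sub_smul']
  have hbc : crossProduct b c = (dotProduct b b) • a - (dotProduct a b) • b := by
    rw [hc, cross_cross_eq_smul_sub_smul']
  rw [hac, hbc] at h2
  simp only [dotProduct_sub, dotProduct_smul, smul_eq_mul] at h2
  rw [dotProduct_add] at hn
  have hkey : dotProduct c c * (dotProduct a a - dotProduct b b) * dotProduct n a = 0 := by
    linear_combination h2 - dotProduct c c * (dotProduct a b - dotProduct a a) * hn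
  have hna : dotProduct n a = 0 := by
    rcases mul_eq_zero.1 hkey with h' | h'
    · rcases mul_eq_zero.1 h' with h'' | h''
      · exact absurd h'' hcc
      · exact absurd (sub_eq_zero.1 h'') hnorm
    · exact h'
  have hnb : dotProduct n b = 0 := by linarith
  -- Step 3: `n ⊥ a, b, a × b`
  refine eq_zero_of_perp a b n hab hna hnb ?_
  rw [← hc]; exact hnc

/-- **LOCAL RANK LEMMA — proved** (chain / one-shot engine; the card's `LocalRankLemma` verbatim,
re-derived on paper by all three triagers; exact tables `local_rank.py`, `localrank_check.py` on the
item).  For real frequencies `k ∦ d` with `|k|² ≠ |d|²`, a real block `M : k^⊥ → (k+d)^⊥` (`M k = 0`,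
`(k+d)ᵀ M = 0`) annihilated by the single-plane-wave identity against the wave at `d`,
`(v·d)(ω·Mv) + (ω·k)(v·Mv) = 0` for all `v ⊥ k`, `ω ⊥ d`, vanishes.  (Kernel `(k−d) ⊗ α` exactly on
the sphere `|k| = |d|`; void for `k ∥ d`.)  Proof: with `c = k×d`, `Δ = |c|²`, the test directions
`ω ∈ {c, d×c}` and `v ∈ {k×c, c + k×c}` give `Δ(|k|²−|d|²)(k·Mv) = 0`, hence `Mv ⊥ k, d, c`, so `M`
kills `k×c`, `c`, then `d` (from `k×c = (k·d)k − |k|²d`), then everything (reciprocal basis). [folklore] -/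
theorem localRank (k d : Fin 3 → ℝ) (M : Matrix (Fin 3) (Fin 3) ℝ) (hkd : crossProduct k d ≠ 0)
    (hnorm : dotProduct k k ≠ dotProduct d d) (hMk : M.mulVec k = 0) (hrange : Matrix.vecMul (k + d) M = 0)
    (h : ∀ v ω : Fin 3 → ℝ, dotProduct v k = 0 → dotProduct ω d = 0 →
      dotProduct v d * dotProduct ω (M.mulVec v) + dotProduct ω k * dotProduct v (M.mulVec v) = 0) :
    M = 0 := by
  set c : Fin 3 → ℝ := crossProduct k d with hc
  set Δ : ℝ := dotProduct c c with hΔ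
  have hΔ0 : Δ ≠ 0 := fun h0 => hkd (dotProduct_self_eq_zero.1 h0)
  have hΔ' : Δ = dotProduct k k * dotProduct d d - dotProduct k d * dotProduct d k := by
    rw [hΔ, hc, cross_dot_cross]
  -- range condition: `d ⬝ Mv = -(k ⬝ Mv)`
  have hR : ∀ v : Fin 3 → ℝ, dotProduct d (M.mulVec v) = -dotProduct k (M.mulVec v) := by
    intro v
    have h0 : dotProduct (k + d) (M.mulVec v) = 0 := by rw [dotProduct_mulVec, hrange, zero_dotProduct]
    rw [add_dotProduct] at h0
    linarith
  -- test vectors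
  have hck : dotProduct c k = 0 := by rw [hc, dotProduct_comm]; exact dot_self_cross k d
  have hcd : dotProduct c d = 0 := by rw [hc, dotProduct_comm]; exact dot_cross_self k d
  set ω₂ : Fin 3 → ℝ := crossProduct d c with hω₂
  have hω₂d : dotProduct ω₂ d = 0 := by rw [hω₂, dotProduct_comm]; exact dot_self_cross d c
  have hω₂' : ω₂ = (dotProduct d d) • k - (dotProduct k d) • d := by rw [hω₂, hc, cross_cross_eq_smul_sub_smul']
  have hω₂k : dotProduct ω₂ k = Δ := by
    rw [hω₂', sub_dotProduct, smul_dotProduct, smul_dotProduct, smul_eq_mul, smul_eq_mul, hΔ',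
      dotProduct_comm d k]
    ring
  set v₂ : Fin 3 → ℝ := crossProduct k c with hv₂
  have hv₂k : dotProduct v₂ k = 0 := by rw [hv₂, dotProduct_comm]; exact dot_self_cross k c
  have hv₂' : v₂ = (dotProduct k d) • k - (dotProduct k k) • d := by rw [hv₂, hc, cross_cross_eq_smul_sub_smul']
  have hv₂d : dotProduct v₂ d = -Δ := by
    rw [hv₂', sub_dotProduct, smul_dotProduct, smul_dotProduct, smul_eq_mul, smul_eq_mul, hΔ',
      dotProduct_comm d k]
    ring
  -- the two identities: ★1 with `ω = c`, ★2 with `ω = ω₂ = d × c`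
  have star1 : ∀ v : Fin 3 → ℝ, dotProduct v k = 0 → dotProduct v d * dotProduct c (M.mulVec v) = 0 := by
    intro v hv
    have := h v c hv hcd
    rwa [hck, zero_mul, add_zero] at this
  have star2 : ∀ v : Fin 3 → ℝ, dotProduct v k = 0 →
      dotProduct v d * (dotProduct d d * dotProduct k (M.mulVec v) - dotProduct k d * dotProduct d (M.mulVec v)) +
        Δ * dotProduct v (M.mulVec v) = 0 := by
    intro v hv
    have := h v ω₂ hv hω₂d
    rwa [hω₂k, hω₂', sub_dotProduct, smul_dotProduct, smul_dotProduct, smul_eq_mul, smul_eq_mul] at this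
  have hv₂M : ∀ v : Fin 3 → ℝ, dotProduct v₂ (M.mulVec v) =
      dotProduct k d * dotProduct k (M.mulVec v) - dotProduct k k * dotProduct d (M.mulVec v) := by
    intro v
    rw [hv₂', sub_dotProduct, smul_dotProduct, smul_dotProduct, smul_eq_mul, smul_eq_mul]
  -- Step A: `M v₂ = 0`
  have hA : M.mulVec v₂ = 0 := by
    have h2 := star2 v₂ hv₂k
    rw [hv₂d, hv₂M v₂, hR v₂] at h2
    have hσ : Δ * (dotProduct k k - dotProduct d d) * dotProduct k (M.mulVec v₂) = 0 := by
      linear_combination h2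
    have hk0 : dotProduct k (M.mulVec v₂) = 0 := by
      rcases mul_eq_zero.1 hσ with h' | h'
      · rcases mul_eq_zero.1 h' with h'' | h''
        · exact absurd h'' hΔ0
        · exact absurd (sub_eq_zero.1 h'') hnorm
      · exact h'
    have hd0 : dotProduct d (M.mulVec v₂) = 0 := by rw [hR v₂, hk0, neg_zero]
    have hc0 : dotProduct c (M.mulVec v₂) = 0 := by
      have h1 := star1 v₂ hv₂k
      rw [hv₂d] at h1
      exact (mul_eq_zero.1 h1).resolve_left (neg_ne_zero.2 hΔ0)
    refine eq_zero_of_perp k d _ hkd ?_ ?_ ?_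
    · rw [dotProduct_comm]; exact hk0
    · rw [dotProduct_comm]; exact hd0
    · rw [dotProduct_comm]; exact hc0
  -- Step B: `M c = 0` via `v₃ = c + v₂`
  have hcMc : dotProduct c (M.mulVec c) = 0 := by
    have h2 := star2 c hck
    rw [hcd, zero_mul, zero_add] at h2
    exact (mul_eq_zero.1 h2).resolve_left hΔ0
  have hB : M.mulVec c = 0 := by
    have hv₃k : dotProduct (c + v₂) k = 0 := by rw [add_dotProduct, hck, hv₂k, add_zero]
    have hv₃d : dotProduct (c + v₂) d = -Δ := by rw [add_dotProduct, hcd, hv₂d, zero_add]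
    have hMv₃ : M.mulVec (c + v₂) = M.mulVec c := by rw [Matrix.mulVec_add, hA, add_zero]
    have h2 := star2 (c + v₂) hv₃k
    rw [hv₃d, hMv₃, add_dotProduct, hcMc, zero_add, hv₂M c, hR c] at h2
    have hσ : Δ * (dotProduct k k - dotProduct d d) * dotProduct k (M.mulVec c) = 0 := by
      linear_combination h2
    have hk0 : dotProduct k (M.mulVec c) = 0 := by
      rcases mul_eq_zero.1 hσ with h' | h'
      · rcases mul_eq_zero.1 h' with h'' | h''
        · exact absurd h'' hΔ0
        · exact absurd (sub_eq_zero.1 h'') hnorm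
      · exact h'
    have hd0 : dotProduct d (M.mulVec c) = 0 := by rw [hR c, hk0, neg_zero]
    refine eq_zero_of_perp k d _ hkd ?_ ?_ ?_
    · rw [dotProduct_comm]; exact hk0
    · rw [dotProduct_comm]; exact hd0
    · rw [dotProduct_comm]; exact hcMc
  -- Step C: `M d = 0` (from `v₂ = (k·d)k − |k|²d`)
  have hkk : dotProduct k k ≠ 0 := by
    intro h0
    have hk0 : k = 0 := dotProduct_self_eq_zero.1 h0
    apply hkd
    rw [hc, hk0, map_zero, LinearMap.zero_apply]
  have hC : M.mulVec d = 0 := by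
    have h0 : M.mulVec v₂ = (dotProduct k d) • M.mulVec k - (dotProduct k k) • M.mulVec d := by
      rw [hv₂', Matrix.mulVec_sub, Matrix.mulVec_smul, Matrix.mulVec_smul]
    rw [hA, hMk, smul_zero, zero_sub, eq_comm, neg_eq_zero, smul_eq_zero] at h0
    exact h0.resolve_left hkk
  -- Step D: `M = 0` by the reciprocal-basis expansion along `k, d, c`
  have hkdc : dotProduct k (crossProduct d c) = Δ := by
    rw [triple_product_permutation, triple_product_permutation]
  have hall : ∀ x : Fin 3 → ℝ, M.mulVec x = 0 := by
    intro x
    have hdec := triple_decomp k d c x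
    rw [hkdc] at hdec
    have h1 : M.mulVec (Δ • x) = 0 := by
      rw [hdec, Matrix.mulVec_add, Matrix.mulVec_add, Matrix.mulVec_smul, Matrix.mulVec_smul,
        Matrix.mulVec_smul, hMk, hC, ← hc, hB, smul_zero, smul_zero, smul_zero, add_zero, add_zero]
    rw [Matrix.mulVec_smul] at h1
    exact (smul_eq_zero.1 h1).resolve_left hΔ0
  ext i j
  have := congrFun (hall (Pi.single j 1)) i
  rw [Matrix.mulVec_single_one] at this
  simpa using this

end Engine

/-! ## The duality stubs S1, S2 (finite-dimensional; S1 reshaped) -/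

/-- **S1 — `stub_farkas`: DEGREE-3 CONIC DUALITY + CARATHÉODORY (the split).** At fixed
`(f, ν, N, E, ε)`: if there is NO weak certificate — no polynomial cylindrical test `(g, P)` with
level-`N` band-limited fields and `deg P ≤ 2`, and multipliers `λ_b, λ_c ≥ 0`, non-trivial
(`λ_b ≠ 0`, or `λ_c ≠ 0`, or the ROW `u ↦ ⟨F_ν(u), ∇p(u)⟩` is not identically zero on level-`N`
fields — RESHAPED by the lead, see the file header), such that `⟨F_ν(u), ∇p(u)⟩ + λ_b (E − ‖u‖²) + λ_c (ν‖∇u‖² − ε) ≤ 0` at EVERY level-`N` field —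
then a witness of the crux at `(f, ν, N, E, ε)` exists (and may be taken finitely atomic).
Why true: `V_N` (level-`N` fields) is finite-dimensional (frame `Torus.frameField`, coordinates
`pairing_eq_sum_frameG`); the row of `(g, P)` at a level-`N` field depends on `(g, P)` only through the
polynomial FUNCTION `p|_{V_N}` modulo constants (`∇p(u)` is the `V_N`-gradient of `p|_{V_N}`), so the rows
form a finite-dimensional space `R = L(Q)`, `Q` = polynomial functions of degree `≤ 2` on `V_N` vanishing
at `0`; with `Ψ(u) = ((q ↦ L(q)(u)) ∈ Q*, ‖u‖², ν‖∇u‖²)`, either `conv Ψ(V_N)` meets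
`T = {0} × (−∞,E] × [ε,∞)` — then `Σⱼ wⱼ δ_{uⱼ}` is a witness: probability, level-`N`, `‖u‖³`
integrable (`integrable_dirac`), every row `= Σⱼ wⱼ L(q)(uⱼ) = 0`, `ensembleEnergy = Σ wⱼ‖uⱼ‖² ≤ E`,
`ensembleDissipation = ν Σ wⱼ ‖∇uⱼ‖² ≥ ε` — or, separating the compact convex `conv Ψ(B_ρ)` from the
closed convex `T` for every radius `ρ` (`geometric_hahn_banach_compact_closed`; signs of the `T`-part
from its recession directions), normalising and passing to the limit `ρ → ∞` on the unit sphere of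
`Q × ℝ × ℝ`, a non-zero `(q, λ_b, λ_c)` with the weak inequality on all of `V_N`; realise `q` as
`(frameG N, P)` with `deg P ≤ 2` (`q ≠ 0`, `q(0) = 0` ⇒ non-constant). Size M–L (finite-dimensional
convex geometry in Mathlib + atomic-measure and frame bookkeeping). -/
theorem stub_farkas :
    ∀ f : T3 → R3, Torus.IsSmooth f → ∀ (ν : ℝ) (N : ℕ) (E ε : ℝ),
      (¬ ∃ (m : ℕ) (g : Fin m → T3 → R3) (P : MvPolynomial (Fin m) ℝ) (lb lc : ℝ),
          (∀ i, IsBandTest N (g i)) ∧ P.totalDegree ≤ 2 ∧ 0 ≤ lb ∧ 0 ≤ lc ∧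
          (lb ≠ 0 ∨ lc ≠ 0 ∨ ∃ u : H3, IsLevel N u ∧
              Torus.nsGeneratorPairing ν f u (polyGrad g P u) ≠ 0) ∧
          ∀ u : H3, IsLevel N u →
            Torus.nsGeneratorPairing ν f u (polyGrad g P u) + lb * (E - ‖u‖ ^ 2) +
              lc * (ν * (Torus.eGradNormSq ((u : L2T3) : T3 → R3)).toReal - ε) ≤ 0) →
      ∃ μ : Measure H3, IsWitness f ν N E ε μ :=
  Summit.AnomalousDissipation.AnomalousDissipation.Theorems.MomentParityCubicParityLoud.stub_farkas

/-- **S2 — `stub_cubicCasimir`: THE CUBIC PART OF A WEAK CERTIFICATE VANISHES ("order 3 is free",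
dual form).** If `⟨F_ν(u), ∇p(u)⟩ + λ_b (E − ‖u‖²) + λ_c (ν‖∇u‖² − ε) ≤ 0` at every level-`N` field
for a test `(g, P)` with band-limited fields and `deg P ≤ 2`, then the quadratic part
`p₂ = homogeneousComponent 2 P` of the test is a QUADRATIC CASIMIR of level-`N` Galerkin–Euler:
its Euler derivative `⟨F₀(u), ∇p₂(u)⟩ = −(B(u,u), ∇p₂(u))` (`Torus.nsGeneratorPairing 0 0`) vanishes at
every level-`N` field.
Why true: level-`N` fields are stable under `u ↦ t • u`; along that ray the certificate is a real cubic
polynomial in `t` — `(f, ∇p(tu)) = O(t)`, `ν(tu, Δ∇p(tu))`, `∫(tu⊗tu):∇(∇p(0))`, `λ_b t²‖u‖²`,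
`λ_c ν t²‖∇u‖²` are `O(t²)`, and the `t³`-coefficient is `∫(u⊗u):∇(∇p₂(u))` because
`∇p(tu) = ∇p(0) + t ∇p₂(u)` for `deg P ≤ 2` (`pderiv` of `homogeneousComponent`, `polyGrad` is a finite
`sum_smul`, `nsGeneratorPairing_sum_smul`); a cubic bounded above on `ℝ` has zero leading coefficient.
Size M (homogeneity bookkeeping of the three pairings under scaling in `H`, `MvPolynomial` degree
algebra). -/
theorem stub_cubicCasimir :
    ∀ f : T3 → R3, Torus.IsSmooth f → ∀ (ν : ℝ) (N : ℕ) (E ε lb lc : ℝ)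
      (m : ℕ) (g : Fin m → T3 → R3) (P : MvPolynomial (Fin m) ℝ),
      (∀ i, IsBandTest N (g i)) → P.totalDegree ≤ 2 →
      (∀ u : H3, IsLevel N u →
          Torus.nsGeneratorPairing ν f u (polyGrad g P u) + lb * (E - ‖u‖ ^ 2) +
            lc * (ν * (Torus.eGradNormSq ((u : L2T3) : T3 → R3)).toReal - ε) ≤ 0) →
      ∀ u : H3, IsLevel N u →
        Torus.nsGeneratorPairing (d := Fin 3) 0 0 u
          (polyGrad g (MvPolynomial.homogeneousComponent 2 P) u) = 0 :=
  Summit.AnomalousDissipation.AnomalousDissipation.Theorems.MomentParityCubicParityLoud.stub_cubicCasimir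

/-! ## S3 decomposed (coefficient side): the classification of the quadratic Casimirs — stubs S3a, S3b — and the Parseval bridge S3c

Statements byte-identical with `stub_covariantVanishing` / `stub_diagonalClassification` /
`stub_coefficientBridge` of the sibling skeleton `Lines/plane-wave-polarization-recursion.lean`
(triage-merged classification lever shared by all three lines of this crux). -/

/-- **S3a-i `stub_isotypeDecoupling` — MOMENTUM GRADING (size M; reshaped out of the old S3a by the lead).**
For every kernel `A` whose real form `Q_A(c) = Σ_{k,l∈S} Re⟪c k, A k l (c l)⟫` (S = punctured ball of level `N`) is a
quadratic Casimir of Galerkin–Euler (its drift along `k ↦ leraySym k (convectionCoeff S c c k)` vanishes at every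
admissible `c`): (1) its block-diagonal part is a Casimir; (2) for every defect `d ≠ 0` the TRUNCATION of `A` to the entries
`(k,l)` with `l − k ∈ {d, −d}` is a Casimir; (3) (no hypothesis needed) the form regroups by defect:
`Q_A = Q_diag + ½ Σ_{d ∈ [−2N,2N]³, d ≠ 0} Q_{A^[d]}` on admissible `c`.
Why true: admissibility is invariant under the torus characters `(τ_a c) k := mFourier k a • c k` (`a ∈ T³`), the Euler
field is equivariant (`convectionCoeff` sums over `l + m = k`, `mFourier_add`; `leraySym_smul`), so the drift at `τ_a c` is
the real trigonometric polynomial `a ↦ Σ_{k,l} Re (mFourier (l − k) a · Z_kl(c))`; it vanishes identically, hence so does each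
Fourier mode: integrate against `1` and against `mFourier (−d)` over `T³` (`Torus.integral_mFourier`,
`integral_mFourier_neg_mul_mFourier`, TorusTrigPoly) — giving (1) and (2); (3) is `Finset.sum` bookkeeping
(partition the pairs `(k,l)` by `l − k`, pair `d` with `−d`). -/
theorem stub_isotypeDecoupling :
    ∀ (N : ℕ) (A : ((Fin 3 → ℤ) → (Fin 3 → ℤ) → (EuclideanSpace ℂ (Fin 3) →ₗ[ℂ] EuclideanSpace ℂ (Fin 3)))),
      (∀ c : (Fin 3 → ℤ) → EuclideanSpace ℂ (Fin 3), (Torus.IsConjSymm c ∧ Torus.IsTransversal ((Torus.freqBall N).erase (0 : Fin 3 → ℤ)) c ∧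
          ∀ k ∉ ((Torus.freqBall N).erase (0 : Fin 3 → ℤ)), c k = 0) →
          ∑ k ∈ ((Torus.freqBall N).erase (0 : Fin 3 → ℤ)), ∑ l ∈ ((Torus.freqBall N).erase (0 : Fin 3 → ℤ)),
            ((inner ℂ (Torus.leraySym k (Torus.convectionCoeff ((Torus.freqBall N).erase (0 : Fin 3 → ℤ)) c c k)) (A k l (c l))).re +
              (inner ℂ (c k) (A k l (Torus.leraySym l (Torus.convectionCoeff ((Torus.freqBall N).erase (0 : Fin 3 → ℤ)) c c l)))).re) = 0) →
      (∀ c : (Fin 3 → ℤ) → EuclideanSpace ℂ (Fin 3), (Torus.IsConjSymm c ∧ Torus.IsTransversal ((Torus.freqBall N).erase (0 : Fin 3 → ℤ)) c ∧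
          ∀ k ∉ ((Torus.freqBall N).erase (0 : Fin 3 → ℤ)), c k = 0) →
          ∑ k ∈ ((Torus.freqBall N).erase (0 : Fin 3 → ℤ)),
            ((inner ℂ (Torus.leraySym k (Torus.convectionCoeff ((Torus.freqBall N).erase (0 : Fin 3 → ℤ)) c c k)) ((A k k) (c k))).re +
              (inner ℂ (c k) ((A k k) (Torus.leraySym k (Torus.convectionCoeff ((Torus.freqBall N).erase (0 : Fin 3 → ℤ)) c c k)))).re) = 0) ∧
      (∀ d : Fin 3 → ℤ, d ≠ 0 →
        (∀ c : (Fin 3 → ℤ) → EuclideanSpace ℂ (Fin 3), (Torus.IsConjSymm c ∧ Torus.IsTransversal ((Torus.freqBall N).erase (0 : Fin 3 → ℤ)) c ∧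
          ∀ k ∉ ((Torus.freqBall N).erase (0 : Fin 3 → ℤ)), c k = 0) →
            ∑ k ∈ ((Torus.freqBall N).erase (0 : Fin 3 → ℤ)), ∑ l ∈ ((Torus.freqBall N).erase (0 : Fin 3 → ℤ)),
              ((inner ℂ (Torus.leraySym k (Torus.convectionCoeff ((Torus.freqBall N).erase (0 : Fin 3 → ℤ)) c c k)) ((fun k l => if l - k = d ∨ l - k = -d then A k l else 0) k l (c l))).re +
                (inner ℂ (c k) ((fun k l => if l - k = d ∨ l - k = -d then A k l else 0) k l (Torus.leraySym l (Torus.convectionCoeff ((Torus.freqBall N).erase (0 : Fin 3 → ℤ)) c c l)))).re) = 0)) ∧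
      (∀ c : (Fin 3 → ℤ) → EuclideanSpace ℂ (Fin 3), (Torus.IsConjSymm c ∧ Torus.IsTransversal ((Torus.freqBall N).erase (0 : Fin 3 → ℤ)) c ∧
          ∀ k ∉ ((Torus.freqBall N).erase (0 : Fin 3 → ℤ)), c k = 0) →
        (∑ k ∈ ((Torus.freqBall N).erase (0 : Fin 3 → ℤ)), ∑ l ∈ ((Torus.freqBall N).erase (0 : Fin 3 → ℤ)), (inner ℂ (c k) (A k l (c l))).re) =
          (∑ k ∈ ((Torus.freqBall N).erase (0 : Fin 3 → ℤ)), (inner ℂ (c k) ((A k k) (c k))).re) +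
            (1 / 2 : ℝ) * ∑ d ∈ (Fintype.piFinset fun _ : Fin 3 => Finset.Icc (-(2 * (N : ℤ))) (2 * (N : ℤ))).erase 0,
              (∑ k ∈ ((Torus.freqBall N).erase (0 : Fin 3 → ℤ)), ∑ l ∈ ((Torus.freqBall N).erase (0 : Fin 3 → ℤ)), (inner ℂ (c k) ((fun k l => if l - k = d ∨ l - k = -d then A k l else 0) k l (c l))).re)) := by
  sorry

/-- **S3a-ii `stub_killRules` — THE THREE LOCAL KILL RULES for a defect-`d` kernel (size L; reshaped out of the old S3a).**
Fed the two engines (PROVED above, kept as hypotheses), for `d ≠ 0` and a kernel `A` SUPPORTED on the defects `±d`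
(`A k l = 0` unless `l − k = ±d`) whose form is a Casimir, define for `x ∈ ℤ³` the EFFECTIVE BLOCK PAIRING of the class of
`(x, x+d)` (four entries: `(x,x+d)`, `(x+d,x)` and their conjugate partners `(−x−d,−x)`, `(−x,−x−d)`),
`σ_x(p,q) := Re⟪p, A x (x+d) q⟫ + Re⟪q, A (x+d) x p⟫ + Re⟪q̄, A (−x−d) (−x) p̄⟫ + Re⟪p̄, A (−x) (−x−d) q̄⟫`, and
`Dead x :⟺ σ_x(p,q) = 0` for all `p ⊥ x`, `q ⊥ x + d` (bilinear `Σ xⱼ pⱼ = 0`). Then: (SYM) `Dead x → Dead (−x−d)`;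
(ONE-SHOT) `x, x+d, 2x+d ∈ S`, `x ∦ d`, `|x|² ≠ |2x+d|²` ⇒ `Dead x`; (CHAIN, needs `d ∈ S`) `x, x+d ∈ S`, `x ∦ d`, `|x|² ≠ |d|²`,
block `(x−d, x)` dead-or-absent ⇒ `Dead x`; (ISOLATION) `a, b ∈ S`, `a ∦ b`, `|a|² ≠ |b|²`, `a+b, a+b+d ∈ S`, `r := −d−a−b ∉ {±a,±b}`,
blocks `(−d−a, −a)` and `(−d−b, −b)` dead-or-absent ⇒ `Dead (a+b)`; (FORM) if every present block is dead the form vanishes on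
admissible families. Why true (verified numerically by the lead, compute/killclosure/identities.py): evaluate the Casimir identity at
sums of ELEMENTARY admissible families `e(k,v) = v at k, v̄ at −k` and extract multilinear components by real scaling:
ISOLATION — the `(1,1,1)` component of the drift at `e(a,v_a)+e(b,v_b)+e(r,v_r)` (`a+b+r = −d`) is
`Θ_r + Θ_a + Θ_b`, `Θ_r = σ_{a+b}(i·P_{a+b}Γ_r, v̄_r)`, `Γ_r = 2π[(v_a·b)v_b + (v_b·a)v_a]` (present iff `a+b ∈ S`), cyclically;
ONE-SHOT — the `s²t` coefficient of the drift at `s•e(x,v) + t•e(2x+d,w)` is `σ_x(v, i·P_{x+d}G)`, `G = 2π[(v̄·(2x+d))w − (w·x)v̄]`;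
CHAIN — the `st²` coefficient at `s•e(d,w) + t•e(x,v)` is `σ_x(v, i·P_{x+d}Γ₊) + σ_{x−d}(i·P_{x−d}Γ₋, v)`, `Γ₊ = 2π[(w·x)v + (v·d)w]`,
`Γ₋ = 2π[(w̄·x)v − (v·d)w̄]` (each present iff its block is). With dead/absent side blocks the target pairing vanishes on the
image of the couplings; split `σ_x(p,q) = Re⟪p, L q⟫` (`L` complex, compress by `P_x`, `P_{x+d}`) into `Re L`, `Im L` using real and
`i`•real amplitudes, and apply `localRank` (one-shot with `(k,d') := (−x, 2x+d)`, chain with `(k,d') := (x,d)`) / `isolationRank`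
(isolation, `n := P_{a+b}(Im L)u_r`). FORM: `Σ_x ρ_x(c x, c(x+d))` reindexed by the involution `x ↦ −x−d` is `½ Σ_x σ_x = 0`.
Infrastructure: `…DiagonalClassificationExtraction/ExtractionReal` (Fin-6 addition table, `indep_of_cross_ne_zero`, `cx_*` lemmas). -/
theorem stub_killRules :
    (∀ (k d : Fin 3 → ℝ) (M : Matrix (Fin 3) (Fin 3) ℝ),
      crossProduct k d ≠ 0 → dotProduct k k ≠ dotProduct d d →
      M.mulVec k = 0 → Matrix.vecMul (k + d) M = 0 →
      (∀ v ω : Fin 3 → ℝ, dotProduct v k = 0 → dotProduct ω d = 0 →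
        dotProduct v d * dotProduct ω (M.mulVec v) + dotProduct ω k * dotProduct v (M.mulVec v) = 0) →
      M = 0) →
    (∀ a b n : Fin 3 → ℝ, crossProduct a b ≠ 0 → dotProduct a a ≠ dotProduct b b →
      dotProduct n (a + b) = 0 →
      (∀ x y : Fin 3 → ℝ, dotProduct x a = 0 → dotProduct y b = 0 →
        dotProduct x b * dotProduct n y + dotProduct y a * dotProduct n x = 0) →
      n = 0) →
    ∀ (N : ℕ) (d : Fin 3 → ℤ) (A : ((Fin 3 → ℤ) → (Fin 3 → ℤ) → (EuclideanSpace ℂ (Fin 3) →ₗ[ℂ] EuclideanSpace ℂ (Fin 3)))), d ≠ 0 →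
      (∀ k l : Fin 3 → ℤ, l - k ≠ d → l - k ≠ -d → A k l = 0) →
      (∀ c : (Fin 3 → ℤ) → EuclideanSpace ℂ (Fin 3), (Torus.IsConjSymm c ∧ Torus.IsTransversal ((Torus.freqBall N).erase (0 : Fin 3 → ℤ)) c ∧
          ∀ k ∉ ((Torus.freqBall N).erase (0 : Fin 3 → ℤ)), c k = 0) →
          ∑ k ∈ ((Torus.freqBall N).erase (0 : Fin 3 → ℤ)), ∑ l ∈ ((Torus.freqBall N).erase (0 : Fin 3 → ℤ)),
            ((inner ℂ (Torus.leraySym k (Torus.convectionCoeff ((Torus.freqBall N).erase (0 : Fin 3 → ℤ)) c c k)) (A k l (c l))).re +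
              (inner ℂ (c k) (A k l (Torus.leraySym l (Torus.convectionCoeff ((Torus.freqBall N).erase (0 : Fin 3 → ℤ)) c c l)))).re) = 0) →
      ∀ Dead : (Fin 3 → ℤ) → Prop,
        (∀ x : Fin 3 → ℤ, Dead x ↔ ∀ p q : EuclideanSpace ℂ (Fin 3), (∑ j, ((x j : ℤ) : ℂ) * p j) = 0 → (∑ j, (((x + d) j : ℤ) : ℂ) * q j) = 0 →
          ((inner ℂ p ((A x (x + d)) q)).re + (inner ℂ q ((A (x + d) x) p)).re +
            (inner ℂ (EuclideanSpace.conjVec q) ((A (-(x + d)) (-x)) (EuclideanSpace.conjVec p))).re +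
            (inner ℂ (EuclideanSpace.conjVec p) ((A (-x) (-(x + d))) (EuclideanSpace.conjVec q))).re) = 0) →
        (∀ x : Fin 3 → ℤ, Dead x → Dead (-x - d)) ∧
        (∀ x : Fin 3 → ℤ, x ∈ ((Torus.freqBall N).erase (0 : Fin 3 → ℤ)) → x + d ∈ ((Torus.freqBall N).erase (0 : Fin 3 → ℤ)) → 2 • x + d ∈ ((Torus.freqBall N).erase (0 : Fin 3 → ℤ)) →
          crossProduct x d ≠ 0 → x ⬝ᵥ x ≠ (2 • x + d) ⬝ᵥ (2 • x + d) → Dead x) ∧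
        (d ∈ ((Torus.freqBall N).erase (0 : Fin 3 → ℤ)) → ∀ x : Fin 3 → ℤ, x ∈ ((Torus.freqBall N).erase (0 : Fin 3 → ℤ)) → x + d ∈ ((Torus.freqBall N).erase (0 : Fin 3 → ℤ)) →
          crossProduct x d ≠ 0 → x ⬝ᵥ x ≠ d ⬝ᵥ d → (x - d ∈ ((Torus.freqBall N).erase (0 : Fin 3 → ℤ)) → Dead (x - d)) → Dead x) ∧
        (∀ a b : Fin 3 → ℤ, a ∈ ((Torus.freqBall N).erase (0 : Fin 3 → ℤ)) → b ∈ ((Torus.freqBall N).erase (0 : Fin 3 → ℤ)) → crossProduct a b ≠ 0 → a ⬝ᵥ a ≠ b ⬝ᵥ b →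
          a + b ∈ ((Torus.freqBall N).erase (0 : Fin 3 → ℤ)) → a + b + d ∈ ((Torus.freqBall N).erase (0 : Fin 3 → ℤ)) →
          -d - a - b ≠ a → -d - a - b ≠ -a → -d - a - b ≠ b → -d - a - b ≠ -b →
          (-d - a ∈ ((Torus.freqBall N).erase (0 : Fin 3 → ℤ)) → Dead (-d - a)) → (-d - b ∈ ((Torus.freqBall N).erase (0 : Fin 3 → ℤ)) → Dead (-d - b)) → Dead (a + b)) ∧
        ((∀ x : Fin 3 → ℤ, x ∈ ((Torus.freqBall N).erase (0 : Fin 3 → ℤ)) → x + d ∈ ((Torus.freqBall N).erase (0 : Fin 3 → ℤ)) → Dead x) →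
          ∀ c : (Fin 3 → ℤ) → EuclideanSpace ℂ (Fin 3), (Torus.IsConjSymm c ∧ Torus.IsTransversal ((Torus.freqBall N).erase (0 : Fin 3 → ℤ)) c ∧
          ∀ k ∉ ((Torus.freqBall N).erase (0 : Fin 3 → ℤ)), c k = 0) → (∑ k ∈ ((Torus.freqBall N).erase (0 : Fin 3 → ℤ)), ∑ l ∈ ((Torus.freqBall N).erase (0 : Fin 3 → ℤ)), (inner ℂ (c k) (A k l (c l))).re) = 0) := by
  sorry

/-! ## S3a-iii′ THE TWO-REGIME SWEEP (strategist line `rim-split-sweep`): the closure made EVENTUAL in `N` —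
three small lattice stubs (NEW) and the PROVED regime glue `covariantClosure_eventually` -/

section Sweep

open Matrix
open Summit.AnomalousDissipation.AnomalousDissipation.Theorems.MomentParityCubicParityLoud
  (neg_mem_ballErase mem_ballErase_iff)

/-! ### Small defects: ladder chains on non-collinear blocks — `stub_ladderChains` PROVED (no threshold) -/

/-- Squared norms of integer vectors are non-negative. [folklore] -/
theorem dotProduct_self_nonneg_int (v : Fin 3 → ℤ) : 0 ≤ v ⬝ᵥ v := by
  simp only [dotProduct]
  exact Finset.sum_nonneg fun i _ => mul_self_nonneg _

/-- A non-zero integer vector has positive squared norm. [folklore] -/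
theorem dotProduct_self_pos_of_ne_zero {v : Fin 3 → ℤ} (hv : v ≠ 0) : 0 < v ⬝ᵥ v := by
  rcases (dotProduct_self_nonneg_int v).lt_or_eq with h | h
  · exact h
  · exact absurd (dotProduct_self_eq_zero.1 h.symm) hv

/-- **Chord lemma.** Two lattice points `p`, `p + nd` (`n ≥ 1`) of norm `|d|` on a line of direction `d ∦ p` are
consecutive: `n = 1`. [folklore] -/
theorem chord {p d : Fin 3 → ℤ} {n : ℕ} (hp : p ⬝ᵥ p = d ⬝ᵥ d)
    (hq : (p + (n : ℤ) • d) ⬝ᵥ (p + (n : ℤ) • d) = d ⬝ᵥ d) (hn : 1 ≤ n) (hpd : crossProduct p d ≠ 0) :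
    n = 1 := by
  have hlag : crossProduct p d ⬝ᵥ crossProduct p d = p ⬝ᵥ p * (d ⬝ᵥ d) - p ⬝ᵥ d * (d ⬝ᵥ p) :=
    cross_dot_cross p d p d
  have hpos : 0 < crossProduct p d ⬝ᵥ crossProduct p d := dotProduct_self_pos_of_ne_zero hpd
  have hexp : (p + (n : ℤ) • d) ⬝ᵥ (p + (n : ℤ) • d) =
      p ⬝ᵥ p + 2 * (n : ℤ) * (p ⬝ᵥ d) + (n : ℤ) ^ 2 * (d ⬝ᵥ d) := by
    simp only [add_dotProduct, dotProduct_add, smul_dotProduct, dotProduct_smul, smul_eq_mul,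
      dotProduct_comm d p]
    ring
  rw [hexp, hp] at hq
  rw [dotProduct_comm d p, hp] at hlag
  have hn1 : (1 : ℤ) ≤ n := by exact_mod_cast hn
  have hkey : 2 * (p ⬝ᵥ d) = -(n : ℤ) * (d ⬝ᵥ d) := by
    have h0 : (n : ℤ) * (2 * (p ⬝ᵥ d) + (n : ℤ) * (d ⬝ᵥ d)) = 0 := by linear_combination hq
    rcases mul_eq_zero.1 h0 with h | h
    · exfalso; linarith
    · linarith
  have h4 : 4 * (p ⬝ᵥ d) ^ 2 = (n : ℤ) ^ 2 * (d ⬝ᵥ d) ^ 2 := by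
    have := congrArg (fun t => t ^ 2) hkey
    linear_combination this
  have hlt : (n : ℤ) ^ 2 < 4 := by
    by_contra hge
    push Not at hge
    nlinarith [h4, hlag, hpos, hge, sq_nonneg (d ⬝ᵥ d), mul_le_mul_of_nonneg_right hge (sq_nonneg (d ⬝ᵥ d))]
  have hn2 : (n : ℤ) < 2 := by nlinarith
  omega

section Ladder

variable (N : ℕ) (d : Fin 3 → ℤ) (Dead : (Fin 3 → ℤ) → Prop)

/-- For `y, d` in the punctured ball the potential `y·d + N²` is non-negative (`2|y·d| ≤ |y|² + |d|² ≤ 2N²`). [folklore] -/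
theorem potential_nonneg {N : ℕ} {y d : Fin 3 → ℤ}
    (hy : y ∈ (Torus.freqBall N).erase (0 : Fin 3 → ℤ)) (hd : d ∈ (Torus.freqBall N).erase (0 : Fin 3 → ℤ)) :
    0 ≤ y ⬝ᵥ d + ((N : ℤ)) ^ 2 := by
  have hyy := ((mem_ballErase_iff N _).1 hy).2
  have hdd := ((mem_ballErase_iff N _).1 hd).2
  have h0 := dotProduct_self_nonneg_int (y + d)
  have e : (y + d) ⬝ᵥ (y + d) = y ⬝ᵥ y + 2 * (y ⬝ᵥ d) + d ⬝ᵥ d := by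
    simp only [add_dotProduct, dotProduct_add, dotProduct_comm d y]; ring
  linarith

/-- `(x − d) × d = x × d`. [folklore] -/
theorem cross_sub_self_right (x d : Fin 3 → ℤ) : crossProduct (x - d) d = crossProduct x d := by
  rw [map_sub, LinearMap.sub_apply, cross_self, sub_zero]

/-- **Left chain.** CHAIN from the left end of the ladder: a non-collinear present block `(x, x+d)` with no
norm-`|d|` obstruction among `x, x − d, x − 2d, …` (as long as these stay in the ball) is dead — induction on the
potential `x·d + N²`, the left neighbour block being dead (induction) or absent. [folklore] -/
theorem left_chain (hdS : d ∈ (Torus.freqBall N).erase (0 : Fin 3 → ℤ)) (hdd : 0 < d ⬝ᵥ d)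
    (hchn : d ∈ ((Torus.freqBall N).erase (0 : Fin 3 → ℤ)) → ∀ x : Fin 3 → ℤ, x ∈ ((Torus.freqBall N).erase (0 : Fin 3 → ℤ)) →
        x + d ∈ ((Torus.freqBall N).erase (0 : Fin 3 → ℤ)) →
          crossProduct x d ≠ 0 → x ⬝ᵥ x ≠ d ⬝ᵥ d → (x - d ∈ ((Torus.freqBall N).erase (0 : Fin 3 → ℤ)) → Dead (x - d)) → Dead x) :
    ∀ x : Fin 3 → ℤ, x ∈ (Torus.freqBall N).erase (0 : Fin 3 → ℤ) → x + d ∈ (Torus.freqBall N).erase (0 : Fin 3 → ℤ) →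
      crossProduct x d ≠ 0 →
      (∀ j : ℕ, (∀ i : ℕ, i ≤ j → x - (i : ℤ) • d ∈ (Torus.freqBall N).erase (0 : Fin 3 → ℤ)) →
        (x - (j : ℤ) • d) ⬝ᵥ (x - (j : ℤ) • d) ≠ d ⬝ᵥ d) → Dead x := by
  suffices H : ∀ (m : ℕ) (x : Fin 3 → ℤ), Int.toNat (x ⬝ᵥ d + ((N : ℤ)) ^ 2) = m →
      x ∈ (Torus.freqBall N).erase (0 : Fin 3 → ℤ) → x + d ∈ (Torus.freqBall N).erase (0 : Fin 3 → ℤ) →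
      crossProduct x d ≠ 0 →
      (∀ j : ℕ, (∀ i : ℕ, i ≤ j → x - (i : ℤ) • d ∈ (Torus.freqBall N).erase (0 : Fin 3 → ℤ)) →
        (x - (j : ℤ) • d) ⬝ᵥ (x - (j : ℤ) • d) ≠ d ⬝ᵥ d) → Dead x from
    fun x => H _ x rfl
  intro m
  refine Nat.strong_induction_on m fun m ih => ?_
  intro x hm hx hxd hcross hclean
  refine hchn hdS x hx hxd hcross ?_ ?_
  · have h0 := hclean 0 (fun i hi => by rw [Nat.le_zero.1 hi]; simpa using hx)
    simpa using h0
  · intro hxmd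
    have hb : 0 ≤ (x - d) ⬝ᵥ d + ((N : ℤ)) ^ 2 := potential_nonneg hxmd hdS
    have hlt : (x - d) ⬝ᵥ d + ((N : ℤ)) ^ 2 < x ⬝ᵥ d + ((N : ℤ)) ^ 2 := by
      rw [sub_dotProduct]; linarith
    refine ih _ ?_ (x - d) rfl hxmd (by simpa using hx) (by rwa [cross_sub_self_right]) ?_
    · rw [← hm]
      exact (Int.toNat_lt_toNat (lt_of_le_of_lt hb hlt)).2 hlt
    · intro j hj
      have e : x - d - (j : ℤ) • d = x - ((j + 1 : ℕ) : ℤ) • d := by push_cast; module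
      rw [e]
      refine hclean (j + 1) fun i hi => ?_
      rcases i with _ | k
      · simpa using hx
      · have hk : k ≤ j := by omega
        have e' : x - ((k + 1 : ℕ) : ℤ) • d = x - d - (k : ℤ) • d := by push_cast; module
        rw [e']
        exact hj k hk

/-- **Right chain**, through the symmetry `x ↦ −x−d` applied to the left chain of `−x−d`. [folklore] -/
theorem right_chain (hsym : ∀ x : Fin 3 → ℤ, Dead x → Dead (-x - d))
    (hdS : d ∈ (Torus.freqBall N).erase (0 : Fin 3 → ℤ)) (hdd : 0 < d ⬝ᵥ d)
    (hchn : d ∈ ((Torus.freqBall N).erase (0 : Fin 3 → ℤ)) → ∀ x : Fin 3 → ℤ, x ∈ ((Torus.freqBall N).erase (0 : Fin 3 → ℤ)) →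
        x + d ∈ ((Torus.freqBall N).erase (0 : Fin 3 → ℤ)) →
          crossProduct x d ≠ 0 → x ⬝ᵥ x ≠ d ⬝ᵥ d → (x - d ∈ ((Torus.freqBall N).erase (0 : Fin 3 → ℤ)) → Dead (x - d)) → Dead x) :
    ∀ x : Fin 3 → ℤ, x ∈ (Torus.freqBall N).erase (0 : Fin 3 → ℤ) → x + d ∈ (Torus.freqBall N).erase (0 : Fin 3 → ℤ) →
      crossProduct x d ≠ 0 →
      (∀ j : ℕ, (∀ i : ℕ, i ≤ j → x + d + (i : ℤ) • d ∈ (Torus.freqBall N).erase (0 : Fin 3 → ℤ)) →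
        (x + d + (j : ℤ) • d) ⬝ᵥ (x + d + (j : ℤ) • d) ≠ d ⬝ᵥ d) → Dead x := by
  intro x hx hxd hcross hclean
  have hA : -x - d ∈ (Torus.freqBall N).erase (0 : Fin 3 → ℤ) := by
    rw [show -x - d = -(x + d) by abel]; exact neg_mem_ballErase hxd
  have hB : -x - d + d ∈ (Torus.freqBall N).erase (0 : Fin 3 → ℤ) := by
    rw [show -x - d + d = -x by abel]; exact neg_mem_ballErase hx
  have hC : crossProduct (-x - d) d ≠ 0 := by
    have e : crossProduct (-x - d) d = -crossProduct x d := by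
      rw [map_sub, LinearMap.sub_apply, map_neg, LinearMap.neg_apply, cross_self, sub_zero]
    rw [e]; exact neg_ne_zero.2 hcross
  have e : ∀ i : ℕ, -x - d - (i : ℤ) • d = -(x + d + (i : ℤ) • d) := fun i => by module
  have hD : ∀ j : ℕ, (∀ i : ℕ, i ≤ j → -x - d - (i : ℤ) • d ∈ (Torus.freqBall N).erase (0 : Fin 3 → ℤ)) →
      (-x - d - (j : ℤ) • d) ⬝ᵥ (-x - d - (j : ℤ) • d) ≠ d ⬝ᵥ d := by
    intro j hj
    rw [e, neg_dotProduct, dotProduct_neg, neg_neg]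
    refine hclean j fun i hi => ?_
    have := neg_mem_ballErase (hj i hi)
    rwa [e, neg_neg] at this
  have key := left_chain N d Dead hdS hdd hchn (-x - d) hA hB hC hD
  have := hsym _ key
  rwa [show -(-x - d) - d = x by abel] at this

end Ladder

/-- **Stub `stub_ladderChains` (S3a-iii-B of the line `rim-split-sweep`): SMALL DEFECTS, NON-COLLINEAR BLOCKS.**
For `d ≠ 0` with `3|d|² < N²` and any `Dead` closed under SYM, ONE-SHOT and CHAIN, every present block `(x, x+d)` of
the punctured ball with `x × d ≠ 0` is dead. [folklore] -/
theorem stub_ladderChains :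
    ∀ (N : ℕ) (d : Fin 3 → ℤ) (Dead : (Fin 3 → ℤ) → Prop), d ≠ 0 → 3 * (d ⬝ᵥ d) < ((N : ℤ)) ^ 2 →
      (∀ x : Fin 3 → ℤ, Dead x → Dead (-x - d)) →
      (∀ x : Fin 3 → ℤ, x ∈ ((Torus.freqBall N).erase (0 : Fin 3 → ℤ)) → x + d ∈ ((Torus.freqBall N).erase (0 : Fin 3 → ℤ)) → 2 • x + d ∈ ((Torus.freqBall N).erase (0 : Fin 3 → ℤ)) →
          crossProduct x d ≠ 0 → x ⬝ᵥ x ≠ (2 • x + d) ⬝ᵥ (2 • x + d) → Dead x) →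
      (d ∈ ((Torus.freqBall N).erase (0 : Fin 3 → ℤ)) → ∀ x : Fin 3 → ℤ, x ∈ ((Torus.freqBall N).erase (0 : Fin 3 → ℤ)) → x + d ∈ ((Torus.freqBall N).erase (0 : Fin 3 → ℤ)) →
          crossProduct x d ≠ 0 → x ⬝ᵥ x ≠ d ⬝ᵥ d → (x - d ∈ ((Torus.freqBall N).erase (0 : Fin 3 → ℤ)) → Dead (x - d)) → Dead x) →
      ∀ x : Fin 3 → ℤ, x ∈ ((Torus.freqBall N).erase (0 : Fin 3 → ℤ)) → x + d ∈ ((Torus.freqBall N).erase (0 : Fin 3 → ℤ)) →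
        crossProduct x d ≠ 0 → Dead x := by
  intro N d Dead hd hsmall hsym hone hchn x hx hxd hcross
  have hmem := mem_ballErase_iff N
  have hdd : 0 < d ⬝ᵥ d := dotProduct_self_pos_of_ne_zero hd
  have hdS : d ∈ (Torus.freqBall N).erase (0 : Fin 3 → ℤ) := (hmem d).2 ⟨hd, by linarith⟩
  by_cases hL : ∀ j : ℕ, (∀ i : ℕ, i ≤ j → x - (i : ℤ) • d ∈ (Torus.freqBall N).erase (0 : Fin 3 → ℤ)) →
      (x - (j : ℤ) • d) ⬝ᵥ (x - (j : ℤ) • d) ≠ d ⬝ᵥ d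
  · exact left_chain N d Dead hdS hdd hchn x hx hxd hcross hL
  by_cases hR : ∀ j : ℕ, (∀ i : ℕ, i ≤ j → x + d + (i : ℤ) • d ∈ (Torus.freqBall N).erase (0 : Fin 3 → ℤ)) →
      (x + d + (j : ℤ) • d) ⬝ᵥ (x + d + (j : ℤ) • d) ≠ d ⬝ᵥ d
  · exact right_chain N d Dead hsym hdS hdd hchn x hx hxd hcross hR
  push Not at hL hR
  obtain ⟨j₁, -, hj₁⟩ := hL
  obtain ⟨j₂, -, hj₂⟩ := hR
  -- the two obstructions are norm-`|d|` points `p = x − j₁d`, `p + (j₁ + j₂ + 1)d = x + d + j₂d`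
  have hpd : crossProduct (x - (j₁ : ℤ) • d) d ≠ 0 := by
    have e : crossProduct (x - (j₁ : ℤ) • d) d = crossProduct x d := by
      rw [map_sub, LinearMap.sub_apply, map_smul, LinearMap.smul_apply, cross_self, smul_zero, sub_zero]
    rw [e]; exact hcross
  have hq : (x - (j₁ : ℤ) • d + ((j₁ + j₂ + 1 : ℕ) : ℤ) • d) ⬝ᵥ (x - (j₁ : ℤ) • d + ((j₁ + j₂ + 1 : ℕ) : ℤ) • d) = d ⬝ᵥ d := by
    have e : x - (j₁ : ℤ) • d + ((j₁ + j₂ + 1 : ℕ) : ℤ) • d = x + d + (j₂ : ℤ) • d := by push_cast; module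
    rw [e]; exact hj₂
  have hn := chord hj₁ hq (by omega) hpd
  have hj10 : j₁ = 0 := by omega
  have hj20 : j₂ = 0 := by omega
  subst hj10; subst hj20
  simp only [Nat.cast_zero, zero_smul, sub_zero, add_zero] at hj₁ hj₂
  -- equilateral block: ONE-SHOT
  have e1 : (x + d) ⬝ᵥ (x + d) = x ⬝ᵥ x + 2 * (x ⬝ᵥ d) + d ⬝ᵥ d := by
    simp only [add_dotProduct, dotProduct_add, dotProduct_comm d x]; ring
  have e2 : (2 • x + d) ⬝ᵥ (2 • x + d) = 4 * (x ⬝ᵥ x) + 4 * (x ⬝ᵥ d) + d ⬝ᵥ d := by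
    simp only [two_smul, add_dotProduct, dotProduct_add, dotProduct_comm d x]; ring
  have h3 : (2 • x + d) ⬝ᵥ (2 • x + d) = 3 * (d ⬝ᵥ d) := by
    rw [e2]; rw [e1] at hj₂; linarith
  refine hone x hx hxd ?_ hcross ?_
  · refine (hmem _).2 ⟨fun h0 => ?_, by linarith⟩
    rw [h0, dotProduct_zero] at h3
    linarith
  · rw [h3, hj₁]; linarith

/-! ## The rim split (stub `stub_rimSplit`, non-collinear blocks): one metric construction with `≍ N²` slack -/

section Rim

/-- Cast of an integer vector to `ℝ³`. -/
def castVec (v : Fin 3 → ℤ) : Fin 3 → ℝ := fun i => (v i : ℝ)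

@[simp] theorem castVec_apply (v : Fin 3 → ℤ) (i : Fin 3) : castVec v i = (v i : ℝ) := rfl

theorem castVec_add (v w : Fin 3 → ℤ) : castVec (v + w) = castVec v + castVec w := by
  ext i; simp

theorem castVec_sub (v w : Fin 3 → ℤ) : castVec (v - w) = castVec v - castVec w := by
  ext i; simp

theorem castVec_zero : castVec (0 : Fin 3 → ℤ) = 0 := by
  ext i; simp

/-- The integer pairing is the real pairing of the casts. [folklore] -/
theorem cast_dotProduct (v w : Fin 3 → ℤ) : ((v ⬝ᵥ w : ℤ) : ℝ) = castVec v ⬝ᵥ castVec w := by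
  simp [dotProduct, Fin.sum_univ_three]

/-- The integer cross product casts to the real one. [folklore] -/
theorem castVec_cross (v w : Fin 3 → ℤ) : castVec (crossProduct v w) = crossProduct (castVec v) (castVec w) := by
  ext i; fin_cases i <;> simp [cross_apply]

/-- Squared norms of real vectors are non-negative. [folklore] -/
theorem dotProduct_self_nonneg_real (u : Fin 3 → ℝ) : 0 ≤ u ⬝ᵥ u := by
  simp only [dotProduct]
  exact Finset.sum_nonneg fun i _ => mul_self_nonneg _

/-- `|u + e|² = |u|² + 2u·e + |e|²`. [folklore] -/
theorem normSq_add (u e : Fin 3 → ℝ) : (u + e) ⬝ᵥ (u + e) = u ⬝ᵥ u + 2 * (u ⬝ᵥ e) + e ⬝ᵥ e := by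
  simp only [add_dotProduct, dotProduct_add, dotProduct_comm e u]; ring

/-- `|u − e|² = |u|² − 2u·e + |e|²`. [folklore] -/
theorem normSq_sub (u e : Fin 3 → ℝ) : (u - e) ⬝ᵥ (u - e) = u ⬝ᵥ u - 2 * (u ⬝ᵥ e) + e ⬝ᵥ e := by
  simp only [sub_dotProduct, dotProduct_sub, dotProduct_comm e u]; ring

/-- Rounding error bound, squared. [folklore] -/
theorem mul_self_le_of_abs_le_half {t : ℝ} (h : |t| ≤ 1 / 2) : t * t ≤ 1 / 4 := by
  have h' := sq_le_sq' (abs_le.1 h).1 (abs_le.1 h).2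
  nlinarith [h']

/-- Rounding error plus one unit step, squared. [folklore] -/
theorem mul_self_le_of_abs_le_half_add_one {t : ℝ} (h : |t| ≤ 1 / 2) : (t + 1) * (t + 1) ≤ 9 / 4 := by
  have h1 := mul_self_le_of_abs_le_half h
  have h2 := (abs_le.1 h).2
  nlinarith

/-- Unit-step bookkeeping for squared norms: `|a₀+u|² − |x−a₀−u|² = (|a₀|² − |x−a₀|²) + 2 x·u`. [folklore] -/
theorem normSq_diff_shift (x a₀ u : Fin 3 → ℤ) :
    (a₀ + u) ⬝ᵥ (a₀ + u) - (x - (a₀ + u)) ⬝ᵥ (x - (a₀ + u)) =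
      (a₀ ⬝ᵥ a₀ - (x - a₀) ⬝ᵥ (x - a₀)) + 2 * (x ⬝ᵥ u) := by
  have e : x - (a₀ + u) = (x - a₀) - u := by abel
  rw [e]
  simp only [add_dotProduct, dotProduct_add, sub_dotProduct, dotProduct_sub, dotProduct_comm u a₀,
    dotProduct_comm u x, dotProduct_comm a₀ x]
  ring

/-- Weighted Cauchy–Schwarz, polynomial form: `2 u·e ≤ u·u/24 + 24 e·e`. [folklore] -/
theorem two_dot_le (u e : Fin 3 → ℝ) : 2 * (u ⬝ᵥ e) ≤ u ⬝ᵥ u / 24 + 24 * (e ⬝ᵥ e) := by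
  have h := dotProduct_self_nonneg_real (u - (24 : ℝ) • e)
  have ex : (u - (24 : ℝ) • e) ⬝ᵥ (u - (24 : ℝ) • e) = u ⬝ᵥ u - 48 * (u ⬝ᵥ e) + 576 * (e ⬝ᵥ e) := by
    simp only [sub_dotProduct, dotProduct_sub, smul_dotProduct, dotProduct_smul, smul_eq_mul, dotProduct_comm e u]
    ring
  rw [ex] at h
  linarith

/-- … and `−2 u·e ≤ u·u/24 + 24 e·e`. [folklore] -/
theorem neg_two_dot_le (u e : Fin 3 → ℝ) : -(2 * (u ⬝ᵥ e)) ≤ u ⬝ᵥ u / 24 + 24 * (e ⬝ᵥ e) := by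
  have h := two_dot_le u (-e)
  simp only [dotProduct_neg, neg_dotProduct, neg_neg, mul_neg] at h
  exact h

set_option maxHeartbeats 1600000 in
/-- **Stub `stub_rimSplit` (S3a-iii-A of the line `rim-split-sweep`): THE RIM SPLIT.**  For `N ≥ 64` and a present
NON-COLLINEAR block `(x, x+d)` with window `6(x+d)·d ≥ N²` there is a split `x = a + b` into two non-parallel
vectors of the punctured ball of different norms whose `d`-translates leave the ball strictly.  Construction:
`z = μ (x × d)` with `|z|² = (11/12)N² − |x|²/4`, `P = x/2 + z` (so `|P|² = |x − P|² = (11/12)N²`,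
`|P + d|² = |x − P + d|² = (11/12)N² + (x+d)·d ≥ (13/12)N²`), `a = round P` coordinatewise, plus one unit step
`eᵢ` (`xᵢ ≠ 0`) if `|a|² = |x−a|²`; the lattice error `e` has `|e|² ≤ 3` and is absorbed by `2|u·e| ≤ |u|²/24 + 24|e|²`. [folklore] -/
theorem stub_rimSplit :
    ∀ (N : ℕ) (x d : Fin 3 → ℤ), 64 ≤ N →
      x ∈ ((Torus.freqBall N).erase (0 : Fin 3 → ℤ)) → x + d ∈ ((Torus.freqBall N).erase (0 : Fin 3 → ℤ)) → crossProduct x d ≠ 0 →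
      ((N : ℤ)) ^ 2 ≤ 6 * ((x + d) ⬝ᵥ d) →
      ∃ a b : Fin 3 → ℤ, a + b = x ∧ a ∈ ((Torus.freqBall N).erase (0 : Fin 3 → ℤ)) ∧ b ∈ ((Torus.freqBall N).erase (0 : Fin 3 → ℤ)) ∧
        crossProduct a b ≠ 0 ∧ a ⬝ᵥ a ≠ b ⬝ᵥ b ∧
        ((N : ℤ)) ^ 2 < (a + d) ⬝ᵥ (a + d) ∧ ((N : ℤ)) ^ 2 < (b + d) ⬝ᵥ (b + d) := by
  intro N x d hN hx hxd hcross hw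
  have hmem := mem_ballErase_iff N
  obtain ⟨hx0, hxx⟩ := (hmem x).1 hx
  -- real data
  set X : Fin 3 → ℝ := castVec x with hXdef
  set D : Fin 3 → ℝ := castVec d with hDdef
  set Nr : Fin 3 → ℝ := castVec (crossProduct x d) with hNrdef
  have hNR : (64 : ℝ) ≤ N := by exact_mod_cast hN
  have hN2 : (4096 : ℝ) ≤ ((N : ℝ)) ^ 2 := by nlinarith
  have hxxR : X ⬝ᵥ X ≤ ((N : ℝ)) ^ 2 := by
    have : ((x ⬝ᵥ x : ℤ) : ℝ) ≤ (((N : ℤ)) ^ 2 : ℤ) := by exact_mod_cast hxx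
    rw [cast_dotProduct] at this
    simpa using this
  have hxx1 : (1 : ℝ) ≤ X ⬝ᵥ X := by
    have h := dotProduct_self_pos_of_ne_zero hx0
    have : ((1 : ℤ) : ℝ) ≤ ((x ⬝ᵥ x : ℤ) : ℝ) := by exact_mod_cast h
    rw [cast_dotProduct] at this
    simpa using this
  have hwR : ((N : ℝ)) ^ 2 ≤ 6 * ((X + D) ⬝ᵥ D) := by
    have : ((((N : ℤ)) ^ 2 : ℤ) : ℝ) ≤ ((6 * ((x + d) ⬝ᵥ d) : ℤ) : ℝ) := by exact_mod_cast hw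
    rw [Int.cast_mul, cast_dotProduct, castVec_add] at this
    simpa using this
  have hnX : Nr ⬝ᵥ X = 0 := by
    have h : crossProduct x d ⬝ᵥ x = 0 := by rw [dotProduct_comm]; exact dot_self_cross x d
    have : ((crossProduct x d ⬝ᵥ x : ℤ) : ℝ) = 0 := by rw [h]; simp
    rwa [cast_dotProduct] at this
  have hnD : Nr ⬝ᵥ D = 0 := by
    have h : crossProduct x d ⬝ᵥ d = 0 := by rw [dotProduct_comm]; exact dot_cross_self x d
    have : ((crossProduct x d ⬝ᵥ d : ℤ) : ℝ) = 0 := by rw [h]; simp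
    rwa [cast_dotProduct] at this
  have hnn : 0 < Nr ⬝ᵥ Nr := by
    have h := dotProduct_self_pos_of_ne_zero hcross
    have : ((0 : ℤ) : ℝ) < ((crossProduct x d ⬝ᵥ crossProduct x d : ℤ) : ℝ) := by exact_mod_cast h
    rw [cast_dotProduct] at this
    simpa using this
  set T : ℝ := 11 / 12 * ((N : ℝ)) ^ 2 - (X ⬝ᵥ X) / 4 with hT
  have hTpos : 0 < T := by rw [hT]; linarith
  have hT23 : 2 / 3 * ((N : ℝ)) ^ 2 ≤ T := by rw [hT]; linarith
  set μ : ℝ := Real.sqrt (T / (Nr ⬝ᵥ Nr)) with hμ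
  have hμ2 : μ ^ 2 * (Nr ⬝ᵥ Nr) = T := by
    rw [hμ, Real.sq_sqrt (div_nonneg hTpos.le hnn.le)]
    field_simp
  set Z : Fin 3 → ℝ := μ • Nr with hZ
  have hZX : Z ⬝ᵥ X = 0 := by rw [hZ, smul_dotProduct, hnX, smul_zero]
  have hXZ : X ⬝ᵥ Z = 0 := by rw [dotProduct_comm]; exact hZX
  have hZD : Z ⬝ᵥ D = 0 := by rw [hZ, smul_dotProduct, hnD, smul_zero]
  have hDZ : D ⬝ᵥ Z = 0 := by rw [dotProduct_comm]; exact hZD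
  have hZZ : Z ⬝ᵥ Z = T := by
    rw [hZ, smul_dotProduct, dotProduct_smul, smul_eq_mul, smul_eq_mul, ← hμ2]; ring
  set P : Fin 3 → ℝ := (1 / 2 : ℝ) • X + Z with hP
  -- the four exact squared norms of the real split point
  have hPP : P ⬝ᵥ P = 11 / 12 * ((N : ℝ)) ^ 2 := by
    have ex : P ⬝ᵥ P = 1 / 4 * (X ⬝ᵥ X) + Z ⬝ᵥ Z := by
      simp only [hP, add_dotProduct, dotProduct_add, smul_dotProduct, dotProduct_smul, smul_eq_mul, hZX, hXZ]
      ring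
    rw [ex, hZZ, hT]; ring
  have hXP : (X - P) ⬝ᵥ (X - P) = 11 / 12 * ((N : ℝ)) ^ 2 := by
    have ex : (X - P) ⬝ᵥ (X - P) = 1 / 4 * (X ⬝ᵥ X) + Z ⬝ᵥ Z := by
      simp only [hP, sub_dotProduct, dotProduct_sub, add_dotProduct, dotProduct_add, smul_dotProduct,
        dotProduct_smul, smul_eq_mul, hZX, hXZ]
      ring
    rw [ex, hZZ, hT]; ring
  have hPD : (P + D) ⬝ᵥ (P + D) = 11 / 12 * ((N : ℝ)) ^ 2 + (X + D) ⬝ᵥ D := by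
    have ex : (P + D) ⬝ᵥ (P + D) = 1 / 4 * (X ⬝ᵥ X) + Z ⬝ᵥ Z + (X ⬝ᵥ D + D ⬝ᵥ D) := by
      simp only [hP, add_dotProduct, dotProduct_add, smul_dotProduct, dotProduct_smul, smul_eq_mul, hZX, hXZ,
        hZD, hDZ, dotProduct_comm D X]
      ring
    rw [ex, hZZ, hT, add_dotProduct]; ring
  have hXPD : (X - P + D) ⬝ᵥ (X - P + D) = 11 / 12 * ((N : ℝ)) ^ 2 + (X + D) ⬝ᵥ D := by
    have ex : (X - P + D) ⬝ᵥ (X - P + D) = 1 / 4 * (X ⬝ᵥ X) + Z ⬝ᵥ Z + (X ⬝ᵥ D + D ⬝ᵥ D) := by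
      simp only [hP, add_dotProduct, dotProduct_add, sub_dotProduct, dotProduct_sub, smul_dotProduct,
        dotProduct_smul, smul_eq_mul, hZX, hXZ, hZD, hDZ, dotProduct_comm D X]
      ring
    rw [ex, hZZ, hT, add_dotProduct]; ring
  have hWR : ((N : ℝ)) ^ 2 / 6 ≤ (X + D) ⬝ᵥ D := by linarith
  -- CLAIM: any lattice point within squared distance 3 of `P` does everything except possibly `|a|² ≠ |b|²`
  have claim : ∀ a : Fin 3 → ℤ, (castVec a - P) ⬝ᵥ (castVec a - P) ≤ 3 →
      a ∈ ((Torus.freqBall N).erase (0 : Fin 3 → ℤ)) ∧ x - a ∈ ((Torus.freqBall N).erase (0 : Fin 3 → ℤ)) ∧ crossProduct a (x - a) ≠ 0 ∧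
        ((N : ℤ)) ^ 2 < (a + d) ⬝ᵥ (a + d) ∧ ((N : ℤ)) ^ 2 < (x - a + d) ⬝ᵥ (x - a + d) := by
    intro a hE
    set E : Fin 3 → ℝ := castVec a - P with hEdef
    have haE : castVec a = P + E := by rw [hEdef]; abel
    have hE0 : 0 ≤ E ⬝ᵥ E := dotProduct_self_nonneg_real E
    -- (i) |a|² ≤ N²
    have h1 : castVec a ⬝ᵥ castVec a ≤ ((N : ℝ)) ^ 2 := by
      rw [haE, normSq_add]
      have := two_dot_le P E
      linarith
    -- (ii) |x - a|² ≤ N²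
    have h2 : castVec (x - a) ⬝ᵥ castVec (x - a) ≤ ((N : ℝ)) ^ 2 := by
      have e0 : castVec (x - a) = (X - P) - E := by rw [castVec_sub, haE]; abel
      rw [e0, normSq_sub]
      have := neg_two_dot_le (X - P) E
      linarith
    -- (iii) |a + d|² > N²
    have h3 : ((N : ℝ)) ^ 2 < castVec (a + d) ⬝ᵥ castVec (a + d) := by
      have e0 : castVec (a + d) = (P + D) + E := by rw [castVec_add, haE]; abel
      rw [e0, normSq_add]
      have := neg_two_dot_le (P + D) E
      linarith
    -- (iv) |x - a + d|² > N²
    have h4 : ((N : ℝ)) ^ 2 < castVec (x - a + d) ⬝ᵥ castVec (x - a + d) := by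
      have e0 : castVec (x - a + d) = (X - P + D) - E := by rw [castVec_add, castVec_sub, haE]; abel
      rw [e0, normSq_sub]
      have := two_dot_le (X - P + D) E
      linarith
    -- (v) a ≠ 0, (vi) x - a ≠ 0
    have h5 : a ≠ 0 := by
      intro h0
      have e0 : P = -E := by
        have h := haE
        rw [h0, castVec_zero] at h
        exact eq_neg_of_add_eq_zero_left h.symm
      have : P ⬝ᵥ P = E ⬝ᵥ E := by rw [e0, neg_dotProduct, dotProduct_neg, neg_neg]
      linarith
    have h6 : x - a ≠ 0 := by
      intro h0
      have e0 : castVec (x - a) = (X - P) - E := by rw [castVec_sub, haE]; abel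
      rw [h0, castVec_zero] at e0
      have e1 : X - P = E := sub_eq_zero.1 e0.symm
      have : (X - P) ⬝ᵥ (X - P) = E ⬝ᵥ E := by rw [e1]
      linarith
    -- (vii) a × (x - a) ≠ 0
    have h7 : crossProduct a (x - a) ≠ 0 := by
      intro h0
      have hax : crossProduct a x = 0 := by
        rwa [map_sub, cross_self, sub_zero] at h0
      have hR : crossProduct (castVec a) X = 0 := by
        rw [hXdef, ← castVec_cross, hax, castVec_zero]
      rw [haE, map_add, LinearMap.add_apply] at hR
      have hPX : crossProduct P X = crossProduct Z X := by
        rw [hP, map_add, LinearMap.add_apply, map_smul, LinearMap.smul_apply, cross_self, smul_zero, zero_add]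
      rw [hPX] at hR
      have hZXE : crossProduct Z X = -crossProduct E X := eq_neg_of_add_eq_zero_left hR
      have l1 : crossProduct Z X ⬝ᵥ crossProduct Z X = Z ⬝ᵥ Z * (X ⬝ᵥ X) - Z ⬝ᵥ X * (X ⬝ᵥ Z) :=
        cross_dot_cross Z X Z X
      have l2 : crossProduct E X ⬝ᵥ crossProduct E X = E ⬝ᵥ E * (X ⬝ᵥ X) - E ⬝ᵥ X * (X ⬝ᵥ E) :=
        cross_dot_cross E X E X
      have hsq : crossProduct Z X ⬝ᵥ crossProduct Z X = crossProduct E X ⬝ᵥ crossProduct E X := by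
        rw [hZXE, neg_dotProduct, dotProduct_neg, neg_neg]
      rw [l1, l2, hZX, hXZ, hZZ, dotProduct_comm X E] at hsq
      have key : (T - E ⬝ᵥ E) * (X ⬝ᵥ X) = -(E ⬝ᵥ X * (E ⬝ᵥ X)) := by linear_combination hsq
      have hneg : (T - E ⬝ᵥ E) * (X ⬝ᵥ X) ≤ 0 := by rw [key]; exact neg_nonpos.2 (mul_self_nonneg _)
      have hpos : 0 < (T - E ⬝ᵥ E) * (X ⬝ᵥ X) := mul_pos (by linarith) (by linarith)
      linarith
    -- back to `ℤ`
    refine ⟨(hmem a).2 ⟨h5, ?_⟩, (hmem (x - a)).2 ⟨h6, ?_⟩, h7, ?_, ?_⟩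
    · have : ((a ⬝ᵥ a : ℤ) : ℝ) ≤ ((((N : ℤ)) ^ 2 : ℤ) : ℝ) := by rw [cast_dotProduct]; simpa using h1
      exact_mod_cast this
    · have : (((x - a) ⬝ᵥ (x - a) : ℤ) : ℝ) ≤ ((((N : ℤ)) ^ 2 : ℤ) : ℝ) := by rw [cast_dotProduct]; simpa using h2
      exact_mod_cast this
    · have : ((((N : ℤ)) ^ 2 : ℤ) : ℝ) < (((a + d) ⬝ᵥ (a + d) : ℤ) : ℝ) := by rw [cast_dotProduct]; simpa using h3
      exact_mod_cast this
    · have : ((((N : ℤ)) ^ 2 : ℤ) : ℝ) < (((x - a + d) ⬝ᵥ (x - a + d) : ℤ) : ℝ) := by rw [cast_dotProduct]; simpa using h4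
      exact_mod_cast this
  -- the rounded point and the unit correction
  set a₀ : Fin 3 → ℤ := fun i => round (P i) with ha₀
  have hE₀ : ∀ i, |(castVec a₀ - P) i| ≤ 1 / 2 := by
    intro i
    simp only [Pi.sub_apply, castVec_apply, ha₀]
    rw [abs_sub_comm]; exact abs_sub_round (P i)
  have hE₀sq : ∀ i, (castVec a₀ - P) i * (castVec a₀ - P) i ≤ 1 / 4 := fun i =>
    mul_self_le_of_abs_le_half (hE₀ i)
  obtain ⟨i₀, hi₀⟩ : ∃ i, x i ≠ 0 := by
    by_contra h
    push Not at h
    exact hx0 (funext h)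
  by_cases hcase : a₀ ⬝ᵥ a₀ = (x - a₀) ⬝ᵥ (x - a₀)
  · -- correct by one unit step along `e_{i₀}`
    set a : Fin 3 → ℤ := a₀ + Pi.single i₀ 1 with ha
    have hdiff : ∀ i, (castVec a - P) i = (castVec a₀ - P) i + if i = i₀ then 1 else 0 := by
      intro i
      by_cases hi : i = i₀
      · subst hi
        simp only [ha, Pi.sub_apply, Pi.add_apply, castVec_apply, Pi.single_eq_same, Int.cast_add, Int.cast_one,
          if_true]
        ring
      · simp only [ha, Pi.sub_apply, Pi.add_apply, castVec_apply, Pi.single_eq_of_ne hi, Int.cast_add,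
          Int.cast_zero, if_neg hi]
        ring
    have hcoord : ∀ i, (castVec a - P) i * (castVec a - P) i ≤ 1 / 4 + if i = i₀ then 2 else 0 := by
      intro i
      rw [hdiff i]
      by_cases hi : i = i₀
      · rw [if_pos hi, if_pos hi]
        have := mul_self_le_of_abs_le_half_add_one (hE₀ i)
        linarith
      · rw [if_neg hi, if_neg hi, add_zero, add_zero]
        exact hE₀sq i
    have hE : (castVec a - P) ⬝ᵥ (castVec a - P) ≤ 3 := by
      calc (castVec a - P) ⬝ᵥ (castVec a - P)
          = ∑ i, (castVec a - P) i * (castVec a - P) i := rfl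
        _ ≤ ∑ i : Fin 3, ((1 : ℝ) / 4 + if i = i₀ then 2 else 0) := Finset.sum_le_sum fun i _ => hcoord i
        _ = 11 / 4 := by
            rw [Finset.sum_add_distrib, Finset.sum_const, Finset.card_univ, Fintype.card_fin,
              Finset.sum_ite_eq']
            simp
            norm_num
        _ ≤ 3 := by norm_num
    obtain ⟨haS, hbS, hab, hda, hdb⟩ := claim a hE
    refine ⟨a, x - a, by abel, haS, hbS, hab, ?_, hda, by rwa [sub_add_eq_add_sub, add_sub_right_comm] at hdb⟩
    -- norms differ by `2 x_{i₀} ≠ 0`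
    have ex := normSq_diff_shift x a₀ (Pi.single i₀ 1)
    rw [dotProduct_single, mul_one, ← ha] at ex
    intro h
    apply hi₀
    linarith
  · have hE : (castVec a₀ - P) ⬝ᵥ (castVec a₀ - P) ≤ 3 := by
      simp only [dotProduct, Fin.sum_univ_three]
      have h0 := hE₀sq 0
      have h1 := hE₀sq 1
      have h2 := hE₀sq 2
      linarith
    obtain ⟨haS, hbS, hab, hda, hdb⟩ := claim a₀ hE
    exact ⟨a₀, x - a₀, by abel, haS, hbS, hab, hcase, hda, by rwa [sub_add_eq_add_sub, add_sub_right_comm] at hdb⟩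

end Rim


/-! ### Collinear blocks: the generic split — `stub_collinearSplit` PROVED (`N ≥ 8`) -/

section CollinearCore

/-- `|α u + β v|²` for an orthonormal pair. [folklore] -/
theorem normSq_lin {u v : Fin 3 → ℤ} (hu : u ⬝ᵥ u = 1) (hv : v ⬝ᵥ v = 1) (huv : u ⬝ᵥ v = 0) (α β : ℤ) :
    (α • u + β • v) ⬝ᵥ (α • u + β • v) = α * α + β * β := by
  have hvu : v ⬝ᵥ u = 0 := by rw [dotProduct_comm]; exact huv
  simp only [add_dotProduct, dotProduct_add, smul_dotProduct, dotProduct_smul, smul_eq_mul, hu, hv, huv, hvu]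
  ring

/-- `|α u + v|²` for an orthonormal pair. [folklore] -/
theorem normSq_lin1 {u v : Fin 3 → ℤ} (hu : u ⬝ᵥ u = 1) (hv : v ⬝ᵥ v = 1) (huv : u ⬝ᵥ v = 0) (α : ℤ) :
    (α • u + v) ⬝ᵥ (α • u + v) = α * α + 1 := by
  have := normSq_lin hu hv huv α 1
  rwa [one_smul, mul_one] at this

/-- `|x + α u|² = |x|² + 2α x·u + α²` for a unit `u`. [folklore] -/
theorem normSq_add_smul {x u : Fin 3 → ℤ} (hu : u ⬝ᵥ u = 1) (α : ℤ) :
    (x + α • u) ⬝ᵥ (x + α • u) = x ⬝ᵥ x + 2 * α * (x ⬝ᵥ u) + α * α := by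
  simp only [add_dotProduct, dotProduct_add, smul_dotProduct, dotProduct_smul, smul_eq_mul, hu, dotProduct_comm u x]
  ring

/-- A vector with zero cross product against a unit `u` is an integer multiple of `u`. [folklore] -/
theorem eq_smul_of_cross_unit {u w : Fin 3 → ℤ} (hu : u ⬝ᵥ u = 1) (h : crossProduct u w = 0) :
    w = (u ⬝ᵥ w) • u := by
  have := cross_cross_eq_smul_sub_smul' u u w
  rw [h, map_zero, hu, one_smul] at this
  exact (sub_eq_zero.1 this.symm).symm

/-- **Core of the collinear split** (coordinate-free). [folklore] -/
theorem collinearSplit_core (N : ℕ) (x d u v : Fin 3 → ℤ) (hN : 8 ≤ N)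
    (hu : u ⬝ᵥ u = 1) (hv : v ⬝ᵥ v = 1) (huv : u ⬝ᵥ v = 0) (huxv : crossProduct u v ≠ 0)
    (ht : x ⬝ᵥ u ≠ 0) (hxx : x ⬝ᵥ x ≤ ((N : ℤ)) ^ 2) (hd : d ≠ 0) (hxd : crossProduct x d = 0) :
    ∃ a b : Fin 3 → ℤ, a + b = x ∧ (a ≠ 0 ∧ a ⬝ᵥ a ≤ ((N : ℤ)) ^ 2) ∧ (b ≠ 0 ∧ b ⬝ᵥ b ≤ ((N : ℤ)) ^ 2) ∧
      crossProduct a b ≠ 0 ∧ a ⬝ᵥ a ≠ b ⬝ᵥ b ∧ crossProduct a d ≠ 0 ∧ crossProduct b d ≠ 0 := by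
  have hN2 : (64 : ℤ) ≤ ((N : ℤ)) ^ 2 := by
    have : (8 : ℤ) ≤ N := by exact_mod_cast hN
    nlinarith
  set t : ℤ := x ⬝ᵥ u with htdef
  -- the sign of `t`
  obtain ⟨s, hs1, hst⟩ : ∃ s : ℤ, s * s = 1 ∧ 1 ≤ s * t := by
    rcases lt_or_gt_of_ne ht with h | h
    · exact ⟨-1, by norm_num, by linarith⟩
    · exact ⟨1, by norm_num, by linarith⟩
  have hs0 : s ≠ 0 := by rintro rfl; norm_num at hs1
  have hvu : v ⬝ᵥ u = 0 := by rw [dotProduct_comm]; exact huv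
  -- Lagrange: `t² ≤ |x|²`
  have hlag : t * t ≤ x ⬝ᵥ x := by
    have l := cross_dot_cross x u x u
    rw [hu, dotProduct_comm u x, ← htdef] at l
    have h0 : 0 ≤ crossProduct x u ⬝ᵥ crossProduct x u := by
      simp only [dotProduct]; exact Finset.sum_nonneg fun i _ => mul_self_nonneg _
    nlinarith
  -- useful: `d` is a non-zero multiple of `u` as soon as `u × d = 0`
  have hpar : crossProduct u d = 0 → d = (u ⬝ᵥ d) • u ∧ u ⬝ᵥ d ≠ 0 := by
    intro h
    have e := eq_smul_of_cross_unit hu h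
    refine ⟨e, fun h0 => hd ?_⟩
    rw [e, h0, zero_smul]
  -- a generic packaging lemma for the conclusion
  have pack : ∀ a b : Fin 3 → ℤ, a + b = x → a ⬝ᵥ a ≤ ((N : ℤ)) ^ 2 → b ⬝ᵥ b ≤ ((N : ℤ)) ^ 2 →
      crossProduct a b ≠ 0 → a ⬝ᵥ a ≠ b ⬝ᵥ b → crossProduct b d ≠ 0 →
      ∃ a b : Fin 3 → ℤ, a + b = x ∧ (a ≠ 0 ∧ a ⬝ᵥ a ≤ ((N : ℤ)) ^ 2) ∧ (b ≠ 0 ∧ b ⬝ᵥ b ≤ ((N : ℤ)) ^ 2) ∧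
        crossProduct a b ≠ 0 ∧ a ⬝ᵥ a ≠ b ⬝ᵥ b ∧ crossProduct a d ≠ 0 ∧ crossProduct b d ≠ 0 := by
    intro a b hab haa hbb haxb hne hbd
    have ha0 : a ≠ 0 := by rintro rfl; exact haxb (by rw [map_zero, LinearMap.zero_apply])
    have hb0 : b ≠ 0 := by rintro rfl; exact haxb (by rw [map_zero])
    have had : crossProduct a d ≠ 0 := by
      have e : crossProduct a d = -crossProduct b d := by
        have : a = x - b := eq_sub_of_add_eq hab
        rw [this, map_sub, LinearMap.sub_apply, hxd, zero_sub]
      rw [e]; exact neg_ne_zero.2 hbd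
    exact ⟨a, b, hab, ⟨ha0, haa⟩, ⟨hb0, hbb⟩, haxb, hne, had, hbd⟩
  by_cases hP : crossProduct x u ≠ 0
  · -- `x ∦ u`; then `u ∦ d`
    have hud : crossProduct u d ≠ 0 := by
      intro h
      obtain ⟨e, hc⟩ := hpar h
      apply hP
      have : crossProduct x d = (u ⬝ᵥ d) • crossProduct x u := by
        calc crossProduct x d = crossProduct x ((u ⬝ᵥ d) • u) := by rw [← e]
          _ = (u ⬝ᵥ d) • crossProduct x u := by rw [map_smul]
      rw [hxd] at this
      exact ((smul_eq_zero.1 this.symm).resolve_left hc)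
    by_cases hn : x ⬝ᵥ x ≠ 2 * s * t
    · -- (a, b) = (x − s u, s u)
      refine pack (x + (-s) • u) (s • u) (by module) ?_ ?_ ?_ ?_ ?_
      · rw [normSq_add_smul hu]; nlinarith
      · rw [smul_dotProduct, dotProduct_smul, smul_eq_mul, smul_eq_mul, hu]; nlinarith
      · have e : crossProduct (x + (-s) • u) (s • u) = s • crossProduct x u := by
          simp only [map_add, map_smul, LinearMap.add_apply, LinearMap.smul_apply, cross_self, smul_zero, add_zero]
        rw [e]; exact smul_ne_zero hs0 hP
      · rw [normSq_add_smul hu, smul_dotProduct, dotProduct_smul, smul_eq_mul, smul_eq_mul, hu, ← htdef]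
        intro h; apply hn; nlinarith
      · rw [map_smul, LinearMap.smul_apply]; exact smul_ne_zero hs0 hud
    · -- (a, b) = (x + s u, −s u); here `|x|² = 2|t|`, so `|t| ≤ 2`
      push Not at hn
      have ht2 : s * t ≤ 2 := by nlinarith
      refine pack (x + s • u) ((-s) • u) (by module) ?_ ?_ ?_ ?_ ?_
      · rw [normSq_add_smul hu, ← htdef]; nlinarith
      · rw [smul_dotProduct, dotProduct_smul, smul_eq_mul, smul_eq_mul, hu]; nlinarith
      · have e : crossProduct (x + s • u) ((-s) • u) = (-s) • crossProduct x u := by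
          simp only [map_add, map_smul, LinearMap.add_apply, LinearMap.smul_apply, cross_self, smul_zero, add_zero]
        rw [e]; exact smul_ne_zero (neg_ne_zero.2 hs0) hP
      · rw [normSq_add_smul hu, smul_dotProduct, dotProduct_smul, smul_eq_mul, smul_eq_mul, hu, ← htdef]
        intro h; nlinarith
      · rw [map_smul, LinearMap.smul_apply]; exact smul_ne_zero (neg_ne_zero.2 hs0) hud
  · -- `x ∥ u`: `x = t u`, and `d = c u` with `c ≠ 0`
    push Not at hP
    have hxt : x = t • u := by
      have h' : crossProduct u x = 0 := by rw [← cross_anticomm, hP, neg_zero]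
      have := eq_smul_of_cross_unit hu h'
      rwa [dotProduct_comm u x, ← htdef] at this
    have hud0 : crossProduct u d = 0 := by
      have : crossProduct x d = t • crossProduct u d := by rw [hxt, map_smul, LinearMap.smul_apply]
      rw [hxd] at this
      exact (smul_eq_zero.1 this.symm).resolve_left ht
    obtain ⟨hdc, hc⟩ := hpar hud0
    have hxx' : x ⬝ᵥ x = t * t := by
      rw [hxt, smul_dotProduct, dotProduct_smul, smul_eq_mul, smul_eq_mul, hu]; ring
    -- `b = α u + v` is never parallel to `d`, and `x × b = t (u × v)`
    have hbd : ∀ α : ℤ, crossProduct (α • u + v) d ≠ 0 := by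
      intro α h
      rw [hdc, map_smul, map_add, LinearMap.add_apply, map_smul, LinearMap.smul_apply, cross_self, smul_zero,
        zero_add] at h
      have h2 : crossProduct v u = 0 := (smul_eq_zero.1 h).resolve_left hc
      apply huxv
      rw [← cross_anticomm, h2, neg_zero]
    have hxb : ∀ α : ℤ, crossProduct (x - (α • u + v)) (α • u + v) ≠ 0 := by
      intro α
      rw [map_sub, LinearMap.sub_apply, cross_self, sub_zero, hxt, map_smul, LinearMap.smul_apply, map_add,
        map_smul, cross_self, smul_zero, zero_add]
      exact smul_ne_zero ht huxv
    have ha_lin : ∀ α : ℤ, x - (α • u + v) = (t - α) • u + (-1 : ℤ) • v := by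
      intro α; rw [hxt]; module
    by_cases h2 : s * t ≠ 2
    · -- (a, b) = (x − s u − v, s u + v)
      refine pack (x - (s • u + v)) (s • u + v) (by abel) ?_ ?_ (hxb s) ?_ (hbd s)
      · rw [ha_lin, normSq_lin hu hv huv]; nlinarith
      · rw [normSq_lin1 hu hv huv]; nlinarith
      · rw [ha_lin, normSq_lin hu hv huv, normSq_lin1 hu hv huv]
        intro h
        apply h2
        have hts : (t - s) * (t - s) = s * s := by linarith
        have : (t - 2 * s) * t = 0 := by nlinarith
        rcases mul_eq_zero.1 this with h' | h'
        · nlinarith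
        · exact absurd h' ht
    · -- (a, b) = (x − 2 s u − v, 2 s u + v)
      push Not at h2
      refine pack (x - ((2 * s) • u + v)) ((2 * s) • u + v) (by abel) ?_ ?_ (hxb (2 * s)) ?_ (hbd (2 * s))
      · rw [ha_lin, normSq_lin hu hv huv]; nlinarith
      · rw [normSq_lin1 hu hv huv]; nlinarith
      · rw [ha_lin, normSq_lin hu hv huv, normSq_lin1 hu hv huv]
        intro h; nlinarith

end CollinearCore

/-- **Stub `stub_collinearSplit` (S3a-iii-C of the line `rim-split-sweep`): GENERIC SPLIT OF A COLLINEAR VECTOR.**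
For `N ≥ 8`, every `x` of the punctured ball parallel to `d ≠ 0` splits as `x = a + b` with `a, b` in the punctured ball,
non-parallel, of different norms, and neither parallel to `d`. [folklore] -/
theorem stub_collinearSplit :
    ∀ (N : ℕ) (x d : Fin 3 → ℤ), 8 ≤ N → d ≠ 0 → x ∈ ((Torus.freqBall N).erase (0 : Fin 3 → ℤ)) → crossProduct x d = 0 →
      ∃ a b : Fin 3 → ℤ, a + b = x ∧ a ∈ ((Torus.freqBall N).erase (0 : Fin 3 → ℤ)) ∧ b ∈ ((Torus.freqBall N).erase (0 : Fin 3 → ℤ)) ∧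
        crossProduct a b ≠ 0 ∧ a ⬝ᵥ a ≠ b ⬝ᵥ b ∧ crossProduct a d ≠ 0 ∧ crossProduct b d ≠ 0 := by
  intro N x d hN hd hx hxd
  have hmem := mem_ballErase_iff N
  obtain ⟨hx0, hxx⟩ := (hmem x).1 hx
  obtain ⟨i, hi⟩ : ∃ i, x i ≠ 0 := by
    by_contra h
    push Not at h
    exact hx0 (funext h)
  -- the orthonormal pair `(eᵢ, eⱼ)`
  have key : ∀ (u v : Fin 3 → ℤ), u ⬝ᵥ u = 1 → v ⬝ᵥ v = 1 → u ⬝ᵥ v = 0 → crossProduct u v ≠ 0 → x ⬝ᵥ u ≠ 0 →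
      ∃ a b : Fin 3 → ℤ, a + b = x ∧ a ∈ ((Torus.freqBall N).erase (0 : Fin 3 → ℤ)) ∧ b ∈ ((Torus.freqBall N).erase (0 : Fin 3 → ℤ)) ∧
        crossProduct a b ≠ 0 ∧ a ⬝ᵥ a ≠ b ⬝ᵥ b ∧ crossProduct a d ≠ 0 ∧ crossProduct b d ≠ 0 := by
    intro u v hu hv huv huxv ht
    obtain ⟨a, b, hab, ha, hb, h1, h2, h3, h4⟩ := collinearSplit_core N x d u v hN hu hv huv huxv ht hxx hd hxd
    exact ⟨a, b, hab, (hmem a).2 ha, (hmem b).2 hb, h1, h2, h3, h4⟩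
  fin_cases i
  · refine key (Pi.single 0 1) (Pi.single 1 1) (by simp) (by simp) (by simp) ?_ (by rwa [dotProduct_single_one])
    intro h; have := congrFun h 2; simp [cross_apply] at this
  · refine key (Pi.single 1 1) (Pi.single 2 1) (by simp) (by simp) (by simp) ?_ (by rwa [dotProduct_single_one])
    intro h; have := congrFun h 0; simp [cross_apply] at this
  · refine key (Pi.single 2 1) (Pi.single 0 1) (by simp) (by simp) (by simp) ?_ (by rwa [dotProduct_single_one])
    intro h; have := congrFun h 1; simp [cross_apply] at this

/-! ### Regime glue (proved) -/

/-- A `d`-translate of squared norm `> N²` means the corresponding side block is ABSENT. [folklore] -/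
theorem not_mem_ballErase_of_lt {N : ℕ} {a d : Fin 3 → ℤ} (h : ((N : ℤ)) ^ 2 < (a + d) ⬝ᵥ (a + d)) :
    -d - a ∉ ((Torus.freqBall N).erase (0 : Fin 3 → ℤ)) := by
  intro hm
  have h2 := ((mem_ballErase_iff N _).1 hm).2
  have e : (-d - a) ⬝ᵥ (-d - a) = (a + d) ⬝ᵥ (a + d) := by
    have : -d - a = -(a + d) := by abel
    rw [this, neg_dotProduct, dotProduct_neg, neg_neg]
  rw [e] at h2
  exact absurd (lt_of_lt_of_le h h2) (lt_irrefl _)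

/-- **Isolation with two absent side blocks** kills a block outright: the four non-degeneracy clauses of the
rule follow from the strict inequalities (`r = ±a, ±b` would put `|a+d|²` or `|b+d|²` at `|x|² ≤ N²` or at `0`). [folklore] -/
theorem dead_of_isoAbsent (N : ℕ) (d : Fin 3 → ℤ) (Dead : (Fin 3 → ℤ) → Prop)
    (hiso : ∀ a b : Fin 3 → ℤ, a ∈ ((Torus.freqBall N).erase (0 : Fin 3 → ℤ)) → b ∈ ((Torus.freqBall N).erase (0 : Fin 3 → ℤ)) → crossProduct a b ≠ 0 → a ⬝ᵥ a ≠ b ⬝ᵥ b →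
          a + b ∈ ((Torus.freqBall N).erase (0 : Fin 3 → ℤ)) → a + b + d ∈ ((Torus.freqBall N).erase (0 : Fin 3 → ℤ)) →
          -d - a - b ≠ a → -d - a - b ≠ -a → -d - a - b ≠ b → -d - a - b ≠ -b →
          (-d - a ∈ ((Torus.freqBall N).erase (0 : Fin 3 → ℤ)) → Dead (-d - a)) → (-d - b ∈ ((Torus.freqBall N).erase (0 : Fin 3 → ℤ)) → Dead (-d - b)) → Dead (a + b))
    {x a b : Fin 3 → ℤ} (hx : x ∈ ((Torus.freqBall N).erase (0 : Fin 3 → ℤ))) (hxd : x + d ∈ ((Torus.freqBall N).erase (0 : Fin 3 → ℤ))) (hab : a + b = x) (ha : a ∈ ((Torus.freqBall N).erase (0 : Fin 3 → ℤ))) (hb : b ∈ ((Torus.freqBall N).erase (0 : Fin 3 → ℤ)))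
    (haxb : crossProduct a b ≠ 0) (hnorm : a ⬝ᵥ a ≠ b ⬝ᵥ b)
    (hda : ((N : ℤ)) ^ 2 < (a + d) ⬝ᵥ (a + d)) (hdb : ((N : ℤ)) ^ 2 < (b + d) ⬝ᵥ (b + d)) : Dead x := by
  subst hab
  have hxx := ((mem_ballErase_iff N _).1 hx).2
  have hN0 : (0 : ℤ) ≤ ((N : ℤ)) ^ 2 := sq_nonneg _
  refine hiso a b ha hb haxb hnorm hx hxd ?_ ?_ ?_ ?_
    (fun hm => absurd hm (not_mem_ballErase_of_lt hda)) (fun hm => absurd hm (not_mem_ballErase_of_lt hdb))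
  · intro h
    have e : a + d = -(a + b) := by
      ext i; have hi := congrFun h i
      simp only [Pi.sub_apply, Pi.neg_apply, Pi.add_apply] at hi ⊢; linarith
    have : (a + d) ⬝ᵥ (a + d) = (a + b) ⬝ᵥ (a + b) := by rw [e, neg_dotProduct, dotProduct_neg, neg_neg]
    linarith
  · intro h
    have e : b + d = 0 := by
      ext i; have hi := congrFun h i
      simp only [Pi.sub_apply, Pi.neg_apply, Pi.add_apply, Pi.zero_apply] at hi ⊢; linarith
    have : (b + d) ⬝ᵥ (b + d) = 0 := by rw [e, dotProduct_zero]
    linarith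
  · intro h
    have e : b + d = -(a + b) := by
      ext i; have hi := congrFun h i
      simp only [Pi.sub_apply, Pi.neg_apply, Pi.add_apply] at hi ⊢; linarith
    have : (b + d) ⬝ᵥ (b + d) = (a + b) ⬝ᵥ (a + b) := by rw [e, neg_dotProduct, dotProduct_neg, neg_neg]
    linarith
  · intro h
    have e : a + d = 0 := by
      ext i; have hi := congrFun h i
      simp only [Pi.sub_apply, Pi.neg_apply, Pi.add_apply, Pi.zero_apply] at hi ⊢; linarith
    have : (a + d) ⬝ᵥ (a + d) = 0 := by rw [e, dotProduct_zero]
    linarith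

/-- `(-d - a) × d = -(a × d)`. [folklore] -/
theorem cross_neg_sub (a d : Fin 3 → ℤ) : crossProduct (-d - a) d = -crossProduct a d := by
  rw [map_sub, LinearMap.sub_apply, map_neg, LinearMap.neg_apply, cross_self, neg_zero, zero_sub]

/-- **THE TWO-REGIME SWEEP — `stub_covariantClosure` made eventual — A THEOREM** (v3: all three lattice lemmas
`stub_ladderChains`, `stub_rimSplit`, `stub_collinearSplit` are proved above; no `sorry` in its cone).  For `N ≥ 64`, `d ≠ 0` and any `Dead` closed
under the four rule schemas of `stub_killRules`, every present block is dead.  Step 1, NON-COLLINEAR blocks: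
small defects `3|d|² < N²` by `stub_ladderChains`; large defects by the rim split at the better of the two representatives
`x`, `−x−d` (windows `(x+d)·d + (−x)·d = |d|²`) and isolation with two ABSENT side blocks (then SYM).  Step 2,
COLLINEAR blocks: isolation at the generic split of `stub_collinearSplit`, whose side blocks are non-collinear (dead
by step 1) or absent. [folklore] -/
theorem covariantClosure_eventually :
    ∃ N₁ : ℕ, ∀ (N : ℕ) (d : Fin 3 → ℤ) (Dead : (Fin 3 → ℤ) → Prop), N₁ ≤ N → d ≠ 0 →
      (∀ x : Fin 3 → ℤ, Dead x → Dead (-x - d)) →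
      (∀ x : Fin 3 → ℤ, x ∈ ((Torus.freqBall N).erase (0 : Fin 3 → ℤ)) → x + d ∈ ((Torus.freqBall N).erase (0 : Fin 3 → ℤ)) → 2 • x + d ∈ ((Torus.freqBall N).erase (0 : Fin 3 → ℤ)) →
          crossProduct x d ≠ 0 → x ⬝ᵥ x ≠ (2 • x + d) ⬝ᵥ (2 • x + d) → Dead x) →
      (d ∈ ((Torus.freqBall N).erase (0 : Fin 3 → ℤ)) → ∀ x : Fin 3 → ℤ, x ∈ ((Torus.freqBall N).erase (0 : Fin 3 → ℤ)) → x + d ∈ ((Torus.freqBall N).erase (0 : Fin 3 → ℤ)) →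
          crossProduct x d ≠ 0 → x ⬝ᵥ x ≠ d ⬝ᵥ d → (x - d ∈ ((Torus.freqBall N).erase (0 : Fin 3 → ℤ)) → Dead (x - d)) → Dead x) →
      (∀ a b : Fin 3 → ℤ, a ∈ ((Torus.freqBall N).erase (0 : Fin 3 → ℤ)) → b ∈ ((Torus.freqBall N).erase (0 : Fin 3 → ℤ)) → crossProduct a b ≠ 0 → a ⬝ᵥ a ≠ b ⬝ᵥ b →
          a + b ∈ ((Torus.freqBall N).erase (0 : Fin 3 → ℤ)) → a + b + d ∈ ((Torus.freqBall N).erase (0 : Fin 3 → ℤ)) →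
          -d - a - b ≠ a → -d - a - b ≠ -a → -d - a - b ≠ b → -d - a - b ≠ -b →
          (-d - a ∈ ((Torus.freqBall N).erase (0 : Fin 3 → ℤ)) → Dead (-d - a)) → (-d - b ∈ ((Torus.freqBall N).erase (0 : Fin 3 → ℤ)) → Dead (-d - b)) → Dead (a + b)) →
      ∀ x : Fin 3 → ℤ, x ∈ ((Torus.freqBall N).erase (0 : Fin 3 → ℤ)) → x + d ∈ ((Torus.freqBall N).erase (0 : Fin 3 → ℤ)) → Dead x := by
  refine ⟨64, fun N d Dead hN hd hsym hone hchn hiso => ?_⟩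
  -- Step 1: every NON-COLLINEAR present block is dead (two regimes in `|d|`)
  have hNC : ∀ x : Fin 3 → ℤ, x ∈ ((Torus.freqBall N).erase (0 : Fin 3 → ℤ)) → x + d ∈ ((Torus.freqBall N).erase (0 : Fin 3 → ℤ)) → crossProduct x d ≠ 0 → Dead x := by
    intro x hx hxd hcross
    by_cases hsmall : 3 * (d ⬝ᵥ d) < ((N : ℤ)) ^ 2
    · exact stub_ladderChains N d Dead hd hsmall hsym hone hchn x hx hxd hcross
    · push Not at hsmall
      by_cases hrep : d ⬝ᵥ d ≤ 2 * ((x + d) ⬝ᵥ d)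
      · obtain ⟨a, b, hab, ha, hb, haxb, hnorm, hda, hdb⟩ :=
          stub_rimSplit N x d hN hx hxd hcross (by linarith)
        exact dead_of_isoAbsent N d Dead hiso hx hxd hab ha hb haxb hnorm hda hdb
      · push Not at hrep
        have hy : -x - d ∈ ((Torus.freqBall N).erase (0 : Fin 3 → ℤ)) := by
          have e : -x - d = -(x + d) := by abel
          rw [e]; exact neg_mem_ballErase hxd
        have hyd : -x - d + d ∈ ((Torus.freqBall N).erase (0 : Fin 3 → ℤ)) := by
          have e : -x - d + d = -x := by abel
          rw [e]; exact neg_mem_ballErase hx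
        have hyc : crossProduct (-x - d) d ≠ 0 := by
          have e : -x - d = -d - x := by abel
          rw [e, cross_neg_sub]; exact neg_ne_zero.2 hcross
        have hw : ((N : ℤ)) ^ 2 ≤ 6 * ((-x - d + d) ⬝ᵥ d) := by
          have e1 : (-x - d + d) ⬝ᵥ d = -(x ⬝ᵥ d) := by
            have : -x - d + d = -x := by abel
            rw [this, neg_dotProduct]
          have e3 : (x + d) ⬝ᵥ d = x ⬝ᵥ d + d ⬝ᵥ d := add_dotProduct x d d
          rw [e1]; rw [e3] at hrep; linarith
        obtain ⟨a, b, hab, ha, hb, haxb, hnorm, hda, hdb⟩ := stub_rimSplit N (-x - d) d hN hy hyd hyc hw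
        have hDy : Dead (-x - d) := dead_of_isoAbsent N d Dead hiso hy hyd hab ha hb haxb hnorm hda hdb
        have := hsym _ hDy
        have e : -(-x - d) - d = x := by abel
        rwa [e] at this
  -- Step 2: COLLINEAR blocks by isolation at the generic split
  intro x hx hxd
  by_cases hcol : crossProduct x d = 0
  · obtain ⟨a, b, hab, ha, hb, haxb, hnorm, had, hbd⟩ :=
      stub_collinearSplit N x d (le_trans (by norm_num) hN) hd hx hcol
    subst hab
    have e2 : -d - a - b = -d - (a + b) := by abel
    refine hiso a b ha hb haxb hnorm hx hxd ?_ ?_ ?_ ?_ ?_ ?_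
    · intro h
      apply had
      have := congrArg (fun v => crossProduct v d) h
      simp only [e2, map_sub, map_neg, LinearMap.sub_apply, LinearMap.neg_apply, cross_self, hcol,
        neg_zero, sub_zero] at this
      exact this.symm
    · intro h
      apply hbd
      have e : b = -d := by
        ext i; have hi := congrFun h i
        simp only [Pi.sub_apply, Pi.neg_apply] at hi ⊢; linarith
      rw [e, map_neg, LinearMap.neg_apply, cross_self, neg_zero]
    · intro h
      apply hbd
      have := congrArg (fun v => crossProduct v d) h
      simp only [e2, map_sub, map_neg, LinearMap.sub_apply, LinearMap.neg_apply, cross_self, hcol,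
        neg_zero, sub_zero] at this
      exact this.symm
    · intro h
      apply had
      have e : a = -d := by
        ext i; have hi := congrFun h i
        simp only [Pi.sub_apply, Pi.neg_apply] at hi ⊢; linarith
      rw [e, map_neg, LinearMap.neg_apply, cross_self, neg_zero]
    · intro hm
      refine hNC (-d - a) hm ?_ ?_
      · have e : -d - a + d = -a := by abel
        rw [e]; exact neg_mem_ballErase ha
      · rw [cross_neg_sub]; exact neg_ne_zero.2 had
    · intro hm
      refine hNC (-d - b) hm ?_ ?_
      · have e : -d - b + d = -b := by abel
        rw [e]; exact neg_mem_ballErase hb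
      · rw [cross_neg_sub]; exact neg_ne_zero.2 hbd
  · exact hNC x hx hxd hcol

end Sweep

/-- **Covariant vanishing** (the old stub S3a, statement unchanged — PROVED from S3a-i/ii and the eventual sweep S3a-iii′): fed the two engines,
beyond the sweep threshold `N₁` (= 64 on this line) every Casimir kernel has a Casimir diagonal part and its form equals its diagonal form on admissible families.
Pure logic: regroup by defect (S3a-i (3)), and for each `d ≠ 0` the truncated kernel is a supported Casimir (S3a-i (2)) all of
whose present blocks are dead (S3a-ii rules + S3a-iii sweep), hence has zero form (S3a-ii FORM). -/
theorem covariantVanishing :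
    (∀ (k d : Fin 3 → ℝ) (M : Matrix (Fin 3) (Fin 3) ℝ),
      crossProduct k d ≠ 0 → dotProduct k k ≠ dotProduct d d →
      M.mulVec k = 0 → Matrix.vecMul (k + d) M = 0 →
      (∀ v ω : Fin 3 → ℝ, dotProduct v k = 0 → dotProduct ω d = 0 →
        dotProduct v d * dotProduct ω (M.mulVec v) + dotProduct ω k * dotProduct v (M.mulVec v) = 0) →
      M = 0) →
    (∀ a b n : Fin 3 → ℝ, crossProduct a b ≠ 0 → dotProduct a a ≠ dotProduct b b →
      dotProduct n (a + b) = 0 →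
      (∀ x y : Fin 3 → ℝ, dotProduct x a = 0 → dotProduct y b = 0 →
        dotProduct x b * dotProduct n y + dotProduct y a * dotProduct n x = 0) →
      n = 0) →
    ∃ N₁ : ℕ, ∀ N : ℕ, N₁ ≤ N → ∀ A : ((Fin 3 → ℤ) → (Fin 3 → ℤ) → (EuclideanSpace ℂ (Fin 3) →ₗ[ℂ] EuclideanSpace ℂ (Fin 3))),
      (∀ c : (Fin 3 → ℤ) → EuclideanSpace ℂ (Fin 3), (Torus.IsConjSymm c ∧ Torus.IsTransversal ((Torus.freqBall N).erase (0 : Fin 3 → ℤ)) c ∧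
          ∀ k ∉ ((Torus.freqBall N).erase (0 : Fin 3 → ℤ)), c k = 0) →
          ∑ k ∈ ((Torus.freqBall N).erase (0 : Fin 3 → ℤ)), ∑ l ∈ ((Torus.freqBall N).erase (0 : Fin 3 → ℤ)),
            ((inner ℂ (Torus.leraySym k (Torus.convectionCoeff ((Torus.freqBall N).erase (0 : Fin 3 → ℤ)) c c k)) (A k l (c l))).re +
              (inner ℂ (c k) (A k l (Torus.leraySym l (Torus.convectionCoeff ((Torus.freqBall N).erase (0 : Fin 3 → ℤ)) c c l)))).re) = 0) →
      (∀ c : (Fin 3 → ℤ) → EuclideanSpace ℂ (Fin 3), (Torus.IsConjSymm c ∧ Torus.IsTransversal ((Torus.freqBall N).erase (0 : Fin 3 → ℤ)) c ∧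
          ∀ k ∉ ((Torus.freqBall N).erase (0 : Fin 3 → ℤ)), c k = 0) →
          ∑ k ∈ ((Torus.freqBall N).erase (0 : Fin 3 → ℤ)),
            ((inner ℂ (Torus.leraySym k (Torus.convectionCoeff ((Torus.freqBall N).erase (0 : Fin 3 → ℤ)) c c k)) ((A k k) (c k))).re +
              (inner ℂ (c k) ((A k k) (Torus.leraySym k (Torus.convectionCoeff ((Torus.freqBall N).erase (0 : Fin 3 → ℤ)) c c k)))).re) = 0) ∧
      (∀ c : (Fin 3 → ℤ) → EuclideanSpace ℂ (Fin 3), (Torus.IsConjSymm c ∧ Torus.IsTransversal ((Torus.freqBall N).erase (0 : Fin 3 → ℤ)) c ∧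
          ∀ k ∉ ((Torus.freqBall N).erase (0 : Fin 3 → ℤ)), c k = 0) →
          (∑ k ∈ ((Torus.freqBall N).erase (0 : Fin 3 → ℤ)), ∑ l ∈ ((Torus.freqBall N).erase (0 : Fin 3 → ℤ)), (inner ℂ (c k) (A k l (c l))).re) = (∑ k ∈ ((Torus.freqBall N).erase (0 : Fin 3 → ℤ)), (inner ℂ (c k) ((A k k) (c k))).re)) := by
  intro hloc hiso
  obtain ⟨N₁, hsweep⟩ := covariantClosure_eventually
  refine ⟨N₁, fun N hN A hA => ?_⟩
  obtain ⟨hdiag, htr, hregroup⟩ := stub_isotypeDecoupling N A hA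
  refine ⟨hdiag, fun c hc => ?_⟩
  rw [hregroup c hc]
  have hzero : ∀ d ∈ (Fintype.piFinset fun _ : Fin 3 => Finset.Icc (-(2 * (N : ℤ))) (2 * (N : ℤ))).erase 0,
      (∑ k ∈ ((Torus.freqBall N).erase (0 : Fin 3 → ℤ)), ∑ l ∈ ((Torus.freqBall N).erase (0 : Fin 3 → ℤ)), (inner ℂ (c k) ((fun k l => if l - k = d ∨ l - k = -d then A k l else 0) k l (c l))).re) = 0 := by
    intro d hd
    have hd0 : d ≠ 0 := (Finset.mem_erase.1 hd).1
    have hsupp : ∀ k l : Fin 3 → ℤ, l - k ≠ d → l - k ≠ -d →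
        (fun k l => if l - k = d ∨ l - k = -d then A k l else 0) k l = 0 := by
      intro k l h1 h2
      simp only [h1, h2, or_self, if_false]
    obtain ⟨hsym, hone, hchl, hisol, hform⟩ :=
      stub_killRules hloc hiso N d (fun k l => if l - k = d ∨ l - k = -d then A k l else 0) hd0 hsupp (htr d hd0)
        (fun x => ∀ p q : EuclideanSpace ℂ (Fin 3), (∑ j, ((x j : ℤ) : ℂ) * p j) = 0 → (∑ j, (((x + d) j : ℤ) : ℂ) * q j) = 0 →
          ((inner ℂ p (((fun k l => if l - k = d ∨ l - k = -d then A k l else 0) x (x + d)) q)).re + (inner ℂ q (((fun k l => if l - k = d ∨ l - k = -d then A k l else 0) (x + d) x) p)).re +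
            (inner ℂ (EuclideanSpace.conjVec q) (((fun k l => if l - k = d ∨ l - k = -d then A k l else 0) (-(x + d)) (-x)) (EuclideanSpace.conjVec p))).re +
            (inner ℂ (EuclideanSpace.conjVec p) (((fun k l => if l - k = d ∨ l - k = -d then A k l else 0) (-x) (-(x + d))) (EuclideanSpace.conjVec q))).re) = 0)
        (fun x => Iff.rfl)
    exact hform (hsweep N d _ hN hd0 hsym hone hchl hisol) c hc
  rw [Finset.sum_eq_zero hzero, mul_zero, add_zero]

/-- **S3b `stub_diagonalClassification` — TRANSLATION-INVARIANT CASIMIRS ARE `span{E, H}`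
(Kraichnan 1973 JFM 59 §2, doi:10.1017/s0022112073001837, asserted; DHV 1985 p. 219; made a theorem
here).**  Beyond a threshold `N₁`, every block-diagonal kernel `D` whose form `Σ_k Re⟪c k, D k (c k)⟫` is a
Casimir of level-`N` Galerkin–Euler is, on admissible families, `a·Σ_k ‖c k‖² + b·Σ_k Re⟪c k, 2πi k × c k⟫`
(`= a‖u‖²_{L²} + b (u, curl u)` by Parseval, `curlCoeff`/`curl_realTrigPoly`).
Why true: momentum-`0` monomials `{p, q, k}`, `p+q+k = 0`, carry no truncation-dependent coefficient, so
TI Casimirs RESTRICT from level `N+1` to level `N`; `E`, `H` are Casimirs at every level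
(`sum_re_inner_galerkinField_self`; `integral_inner_convect_self_curl_eq_zero`); subtract `aE + bH` fitted
on the ball of radius `N`; each new-shell block `D k` is then pinned to `0` by ONE inner triad
`−k = p + q`, `p, q` in the smaller ball, `|p| ≠ |q|`, `p ∦ q` (map (B) = `isolationRank`, injective; exists for
`N ≥ 5` by balanced rounding of `−k/2 ±` a unit, triage r1-2), so induction from an exact-rank base
level (`N ∈ {3,4}`: nullity 2 in exact arithmetic, evidence inv_N3/inv_N4, casimir_sweep R2 ≤ 11;
the 18-mode accident `|k|² ≤ 2` sits below every integer ball ≥ 2).  Alternative base-free route: Waleffe's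
per-helical-triad relation `σ_k X_k + σ_p X_p + σ_q X_q = 0` has local solutions `span{1, s|k|}`, glued
along triads sharing two helical modes.  Why it might fail: only through a wrong base case (then raise
`N₁`).  Size L. [cite: Kraichnan1973, §2] -/
theorem stub_diagonalClassification :
    ∃ N₁ : ℕ, ∀ N : ℕ, N₁ ≤ N → ∀ D : ((Fin 3 → ℤ) → (EuclideanSpace ℂ (Fin 3) →ₗ[ℂ] EuclideanSpace ℂ (Fin 3))),
      (∀ c : (Fin 3 → ℤ) → EuclideanSpace ℂ (Fin 3), (Torus.IsConjSymm c ∧ Torus.IsTransversal ((Torus.freqBall N).erase (0 : Fin 3 → ℤ)) c ∧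
          ∀ k ∉ (Torus.freqBall N).erase (0 : Fin 3 → ℤ), c k = 0) →
          ∑ k ∈ ((Torus.freqBall N).erase (0 : Fin 3 → ℤ)),
            ((inner ℂ (Torus.leraySym k (Torus.convectionCoeff ((Torus.freqBall N).erase (0 : Fin 3 → ℤ)) c c k)) (D k (c k))).re +
              (inner ℂ (c k) (D k (Torus.leraySym k (Torus.convectionCoeff ((Torus.freqBall N).erase (0 : Fin 3 → ℤ)) c c k)))).re) = 0) →
      ∃ a b : ℝ, ∀ c : (Fin 3 → ℤ) → EuclideanSpace ℂ (Fin 3), (Torus.IsConjSymm c ∧ Torus.IsTransversal ((Torus.freqBall N).erase (0 : Fin 3 → ℤ)) c ∧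
          ∀ k ∉ (Torus.freqBall N).erase (0 : Fin 3 → ℤ), c k = 0) →
        (∑ k ∈ ((Torus.freqBall N).erase (0 : Fin 3 → ℤ)), (inner ℂ (c k) (D k (c k))).re) =
          a * (∑ k ∈ ((Torus.freqBall N).erase (0 : Fin 3 → ℤ)), ‖c k‖ ^ 2) + b * (∑ k ∈ ((Torus.freqBall N).erase (0 : Fin 3 → ℤ)), (inner ℂ (c k) (IntermittentBeltrami.curlCoeff c k)).re) :=
  Summit.AnomalousDissipation.AnomalousDissipation.Theorems.MomentParityCubicParityLoud.stub_diagonalClassification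

/-! ### Bridge: coefficient classification ⇒ test-side QuadRigidity (shared with `QuarticGate/recession-cone` S2(ii)) -/

/-- **S3c `stub_coefficientBridge` — PARSEVAL DICTIONARY.**  At a fixed level `N`: if every coefficient
kernel whose form is a Casimir is `a·energy + b·helicity` on admissible families, then every HOMOGENEOUS
QUADRATIC cylindrical observable `p(u) = P((u,g₁),…,(u,gₘ))` (band-limited tests) whose Euler derivative
`nsGeneratorPairing 0 0 u (∇p(u)) = ∫ (u⊗u):∇(∇p(u))` vanishes at every level-`N` field has
`∇p(u) = 2α P_N u + 2β curl P_N u` at level-`N` fields — literally the QuadRigidity clause of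
`recession-cone.stub_casimirs` (ii) / hypothesis of `stub_order3Surgery`.
Why true (bookkeeping, no idea): `(u, gⱼ) = Σ_k Re⟪û k, ĝⱼ k⟫` (`integral_inner_realTrigPoly_left`), so
`p|_{V_N}` is the form of the explicit kernel `A k l = Σ_{ij} P_{ij} ĝᵢ(k) ⟪ĝⱼ(l), ·⟫`; for the level-`N`
field `u = realTrigPoly ball c` one has `inertialPairing u (Su) = −∫⟪(u·∇)u, Su⟫`
(`integral_inner_convect_eq_neg`) `= −Σ_k Re⟪convectionCoeff … k, (Su)^(k)⟫`
(`mFourierCoeff_convect_realTrigPoly`, Parseval) = the coefficient derivative of the form, so the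
hypothesis is the coefficient Casimir identity; the classification gives `p(u) = a‖P_N u‖² + b(P_N u, curl P_N u)`
(`integral_norm_sq_realTrigPoly`, `curl_realTrigPoly`), and differentiating inside `V_N` (both sides of the
conclusion are `V_N`-valued continuous fields, equal after pairing with every `v ∈ V_N`) gives the
differential with `α = a`, `β = b`.  Size M–L. [folklore] -/
theorem stub_coefficientBridge :
    ∀ N : ℕ,
    (∀ A : ((Fin 3 → ℤ) → (Fin 3 → ℤ) → (EuclideanSpace ℂ (Fin 3) →ₗ[ℂ] EuclideanSpace ℂ (Fin 3))),
        (∀ c : (Fin 3 → ℤ) → EuclideanSpace ℂ (Fin 3), (Torus.IsConjSymm c ∧ Torus.IsTransversal ((Torus.freqBall N).erase (0 : Fin 3 → ℤ)) c ∧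
          ∀ k ∉ (Torus.freqBall N).erase (0 : Fin 3 → ℤ), c k = 0) →
          ∑ k ∈ ((Torus.freqBall N).erase (0 : Fin 3 → ℤ)), ∑ l ∈ ((Torus.freqBall N).erase (0 : Fin 3 → ℤ)),
            ((inner ℂ (Torus.leraySym k (Torus.convectionCoeff ((Torus.freqBall N).erase (0 : Fin 3 → ℤ)) c c k)) (A k l (c l))).re +
              (inner ℂ (c k) (A k l (Torus.leraySym l (Torus.convectionCoeff ((Torus.freqBall N).erase (0 : Fin 3 → ℤ)) c c l)))).re) = 0) →
        ∃ a b : ℝ, ∀ c : (Fin 3 → ℤ) → EuclideanSpace ℂ (Fin 3), (Torus.IsConjSymm c ∧ Torus.IsTransversal ((Torus.freqBall N).erase (0 : Fin 3 → ℤ)) c ∧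
          ∀ k ∉ (Torus.freqBall N).erase (0 : Fin 3 → ℤ), c k = 0) →
          (∑ k ∈ ((Torus.freqBall N).erase (0 : Fin 3 → ℤ)), ∑ l ∈ ((Torus.freqBall N).erase (0 : Fin 3 → ℤ)), (inner ℂ (c k) (A k l (c l))).re) =
            a * (∑ k ∈ ((Torus.freqBall N).erase (0 : Fin 3 → ℤ)), ‖c k‖ ^ 2) + b * (∑ k ∈ ((Torus.freqBall N).erase (0 : Fin 3 → ℤ)), (inner ℂ (c k) (IntermittentBeltrami.curlCoeff c k)).re)) →
    (∀ (m : ℕ) (g : Fin m → UnitAddTorus (Fin 3) → EuclideanSpace ℝ (Fin 3))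
      (P : MvPolynomial (Fin m) ℝ),
      (∀ i, (Torus.IsSmooth (g i) ∧ Torus.IsDivFree (g i) ∧ Torus.HasZeroMean (g i) ∧
        ∀ k ∉ (Torus.freqBall N).erase (0 : Fin 3 → ℤ),
          UnitAddTorus.mFourierCoeff (EuclideanSpace.complexify ∘ (g i)) k = 0)) → P.IsHomogeneous 2 →
      (∀ u : Torus.energySpace (Fin 3), (∀ k ∉ (Torus.freqBall N).erase (0 : Fin 3 → ℤ),
          UnitAddTorus.mFourierCoeff (EuclideanSpace.complexify ∘ (u.1 : UnitAddTorus (Fin 3) → EuclideanSpace ℝ (Fin 3))) k = 0) →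
        Torus.nsGeneratorPairing (d := Fin 3) 0 0 u
          (fun x => ∑ i, (MvPolynomial.eval (fun j => Torus.pairing u.1 (g j))
            (MvPolynomial.pderiv i P)) • g i x) = 0) →
      ∃ α β : ℝ, ∀ u : Torus.energySpace (Fin 3), (∀ k ∉ (Torus.freqBall N).erase (0 : Fin 3 → ℤ),
          UnitAddTorus.mFourierCoeff (EuclideanSpace.complexify ∘ (u.1 : UnitAddTorus (Fin 3) → EuclideanSpace ℝ (Fin 3))) k = 0) →
        ∀ x, (∑ i, (MvPolynomial.eval (fun j => Torus.pairing u.1 (g j))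
            (MvPolynomial.pderiv i P)) • g i x) =
          (2 * α) • Torus.fourierTruncate N (u.1 : UnitAddTorus (Fin 3) → EuclideanSpace ℝ (Fin 3)) x +
          (2 * β) • BDSV.curl (Torus.fourierTruncate N (u.1 : UnitAddTorus (Fin 3) → EuclideanSpace ℝ (Fin 3))) x) := by
  sorry

/-! ## The kill S4 (reshaped non-triviality) and the construction S5 (the menu) -/

/-- **S4 — `stub_noCasimirCertificate`: THE MENU KILLS EVERY CASIMIR-BASED CERTIFICATE (the Farkas
split proper).** Fix a smooth force `f`, `ν > 0`, a level `N`, budgets `E`, `ε > 0` and a dial radius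
`δ > 0`. Assume QuadRigidity at level `N` (the conclusion of S3 at this `N`) and the BALANCED MENU at
`(f, ν, N)`: for every dial `(a, b) ∈ [−δ, δ]²` a probability law on `H` carried by level-`N` fields,
with finite third moments, 1-STATIONARY (every LINEAR row `∫⟨F_ν(u), g⟩dμ = 0`, `g` band-limited),
with ENERGY DRIFT `∫⟨F_ν(u), P_N u⟩dμ = a`, HELICITY DRIFT `∫⟨F_ν(u), curl P_N u⟩dμ = b`, energy `≤ E`
and dissipation `≥ 2ε`. Then no weak certificate at the target constants `(E + 1, ε)` whose test has
a Casimir quadratic part exists.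
Why true (finite-dimensional, each step elementary): write `∇p(u) = G₀ + ∇p₂(u)` with the CONSTANT
band-limited field `G₀ = ∇p(0) = Σᵢ ∂ᵢP(0) gᵢ` (`deg P ≤ 2`); QuadRigidity on `p₂` gives
`∇p₂(u) = 2α P_N u + 2β curl P_N u` at level-`N` fields, so by linearity in the test field
(`nsGeneratorPairing_sum_smul`) the certificate integrates against `μ_{a,b}` (a.e. level-`N`;
integrability: menu clauses, `integrable_norm_pow_of_cube`, Bernstein `eGradNormSq_le_of_isLevel`,
`∫ ν‖∇u‖² dμ = ensembleDissipation ν μ`) to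
`0 + 2αa + 2βb + λ_b((E+1) − energy) + λ_c(dissipation − ε) ≤ 0` with `(E+1) − energy ≥ 1`,
`dissipation − ε ≥ ε`: dial `(0,0)` ⇒ `λ_b = λ_c = 0`; dials `(±δ, 0)`, `(0, ±δ)` ⇒ `α = β = 0`. Hence
`∇p(u) = G₀` on level-`N` fields and `(f, G₀) + ν(u, ΔG₀) + ∫(u⊗u):∇G₀ ≤ 0` for all level-`N` `u`:
the quadratic form `u ↦ ∫(u⊗u):∇G₀ = −(B(u,u), G₀)` on `V_N` is `≤ 0` (scaling) and has zero trace
over the Parseval frame of single real Fourier modes (`Torus.frameField`, each a steady Euler state: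
`(e·∇)e = 0` for `e = a cos(2πk·x)`, `a ⊥ k`; `sum_integral_inner_frameField_sq`), so it vanishes; then
the affine residual forces `(u, ΔG₀) = 0` for all `u ∈ V_N`, in particular `‖∇G₀‖² = 0`, `G₀ = 0`
(mean zero; HERE `ν > 0` is used). So `∇p ≡ 0` on level-`N` fields, `p` is constant there
(segments stay at level `N`), contradicting non-triviality. Size M–L. -/
theorem stub_noCasimirCertificate :
    ∀ f : T3 → R3, Torus.IsSmooth f → ∀ ν : ℝ, 0 < ν → ∀ (N : ℕ) (E ε δ : ℝ), 0 < ε → 0 < δ →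
      -- QuadRigidity at level `N` (conclusion of S3 at this level)
      (∀ (m : ℕ) (g : Fin m → T3 → R3) (P : MvPolynomial (Fin m) ℝ),
        (∀ i, IsBandTest N (g i)) → P.IsHomogeneous 2 →
        (∀ u : H3, IsLevel N u →
            Torus.nsGeneratorPairing (d := Fin 3) 0 0 u (polyGrad g P u) = 0) →
        ∃ α β : ℝ, ∀ u : H3, IsLevel N u → ∀ x : T3,
          polyGrad g P u x =
            (2 * α) • Torus.fourierTruncate N ((u : L2T3) : T3 → R3) x +
              (2 * β) • BDSV.curl (Torus.fourierTruncate N ((u : L2T3) : T3 → R3)) x) →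
      -- the balanced menu at `(f, ν, N)` with dials in `[−δ, δ]²`, budgets `(E, 2ε)`
      (∀ a b : ℝ, |a| ≤ δ → |b| ≤ δ → ∃ μ : Measure H3,
          IsProbabilityMeasure μ ∧ (∀ᵐ u ∂μ, IsLevel N u) ∧
          Integrable (fun u : H3 => ‖u‖ ^ 3) μ ∧
          (∀ g : T3 → R3, IsBandTest N g →
              Integrable (fun u : H3 => Torus.nsGeneratorPairing ν f u g) μ ∧
                ∫ u, Torus.nsGeneratorPairing ν f u g ∂μ = 0) ∧
          (Integrable (fun u : H3 => Torus.nsGeneratorPairing ν f u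
              (Torus.fourierTruncate N ((u : L2T3) : T3 → R3))) μ ∧
            ∫ u, Torus.nsGeneratorPairing ν f u
              (Torus.fourierTruncate N ((u : L2T3) : T3 → R3)) ∂μ = a) ∧
          (Integrable (fun u : H3 => Torus.nsGeneratorPairing ν f u
              (BDSV.curl (Torus.fourierTruncate N ((u : L2T3) : T3 → R3)))) μ ∧
            ∫ u, Torus.nsGeneratorPairing ν f u
              (BDSV.curl (Torus.fourierTruncate N ((u : L2T3) : T3 → R3))) ∂μ = b) ∧
          Torus.ensembleEnergy μ ≤ E ∧ 2 * ε ≤ Torus.ensembleDissipation ν μ) →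
      -- conclusion: no weak certificate at `(E + 1, ε)` with a Casimir quadratic part
      ∀ (m : ℕ) (g : Fin m → T3 → R3) (P : MvPolynomial (Fin m) ℝ) (lb lc : ℝ),
        (∀ i, IsBandTest N (g i)) → P.totalDegree ≤ 2 → 0 ≤ lb → 0 ≤ lc →
        (lb ≠ 0 ∨ lc ≠ 0 ∨ ∃ u : H3, IsLevel N u ∧
            Torus.nsGeneratorPairing ν f u (polyGrad g P u) ≠ 0) →
        (∀ u : H3, IsLevel N u →
            Torus.nsGeneratorPairing ν f u (polyGrad g P u) + lb * ((E + 1) - ‖u‖ ^ 2) +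
              lc * (ν * (Torus.eGradNormSq ((u : L2T3) : T3 → R3)).toReal - ε) ≤ 0) →
        (∀ u : H3, IsLevel N u →
            Torus.nsGeneratorPairing (d := Fin 3) 0 0 u
              (polyGrad g (MvPolynomial.homogeneousComponent 2 P) u) = 0) →
        False :=
  Summit.AnomalousDissipation.AnomalousDissipation.Theorems.MomentParityCubicParityLoud.stub_noCasimirCertificate

/-- **S5 — `stub_balancedMenu`: THE TWO-DIAL MENU OF 1-STATIONARY ATOM CLOUDS (the only
construction; first and second moments only).** For every smooth divergence-free mean-zero `f ≠ 0`
there are `E`, `ε > 0`, `ν₀ > 0`, `δ > 0` such that for all `ν ∈ (0, ν₀)` and all `N ≥ N₀(ν)`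
(`N₀ ≍ ν^{-1/2}`) and every dial `(a, b) ∈ [−δ, δ]²` there is a probability law on `H`, carried by
level-`N` fields, with finite third moments, whose LINEAR rows all vanish (exact mean-flow /
Reynolds-stress balance `P_N f + νΔm = B_N(second moment)`), with energy drift
`∫⟨F_ν(u), P_N u⟩dμ = a`, helicity drift `∫⟨F_ν(u), curl P_N u⟩dμ = b`, energy `≤ E` and dissipation
`≥ 2ε`.
Why plausibly true (card § Lever, triage r1-2/r1-3 "no defect found"): since `f ≠ 0` is continuous some
`f̂(p₀) ≠ 0`, `p₀ ≠ 0` (mean zero), `f̂(p₀) ⊥ p₀` (div-free) — the three load-bearing hypotheses are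
consumed exactly here; MEAN FLOW `m = c · f^{(p₀)}` (the `±p₀` mode pair of `f`, a steady Euler state,
`(f, m) = c‖f^{(p₀)}‖² > 0`); four-phase STRESS PACKETS `Re(e^{iθ}(x e_k + y e_{k+q}))`,
`θ ∈ {0, π/2, π, 3π/2}`, `k = −sign(qᵢ)eᵢ` (so `k + q` stays in the ball), whose covariance lives at
shift `±q` only and realises `R = P_N f + νΔm` mode by mode at energy `≲ Σ_q |R̂(q)|/|q|` and
enstrophy `≲ Σ_q |q||R̂(q)|`, summable uniformly in `N, ν` for smooth `f`; a random-phase two-helicity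
SEA on the Taylor shell `|k|² ≈ K(ν)² = ε/(4π²ν E_sea)` (`K ≍ ν^{-1/2}`, `N₀ := 2K`), translation
invariant (zero mean stress), whose enstrophy sets `dissipation = (f,m) − a` (energy row: `a` dial;
`(f, m) := 4ε + …`) and whose chirality fraction `χ ≍ ν^{1/2}` sets the helicity drift
(capacity `≍ ν K³ E_sea χ ≍ ε K χ`, so `|b| ≤ δ` is reachable). All phases finite ⇒ `μ` is a finite
convex combination of Diracs at level-`N` trigonometric polynomials; every menu identity is a finite
trigonometric-coefficient computation on sums of single modes (`pair_formula`, `frameField`,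
`mFourierCoeff_convect_realTrigPoly`, `toReal_eGradNormSq_realTrigPoly`, `curl_realTrigPoly`,
`integrable_dirac`, `nsGeneratorPairing_sum_smul`). Nearest in-tree relative: `stub_order2Design` (S6) of
line `recession-cone` (one Kolmogorov force, dials `(0,0)`, no slack) — its packet/sea bookkeeping
transfers. Size L (explicit but long). -/
theorem stub_balancedMenu :
    ∀ f : T3 → R3, Torus.IsSmooth f → Torus.IsDivFree f → Torus.HasZeroMean f → f ≠ 0 →
      ∃ E ε ν₀ δ : ℝ, 0 < ε ∧ 0 < ν₀ ∧ 0 < δ ∧ ∀ ν : ℝ, 0 < ν → ν < ν₀ →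
        ∃ N₀ : ℕ, ∀ N : ℕ, N₀ ≤ N → ∀ a b : ℝ, |a| ≤ δ → |b| ≤ δ → ∃ μ : Measure H3,
          IsProbabilityMeasure μ ∧ (∀ᵐ u ∂μ, IsLevel N u) ∧
          Integrable (fun u : H3 => ‖u‖ ^ 3) μ ∧
          (∀ g : T3 → R3, IsBandTest N g →
              Integrable (fun u : H3 => Torus.nsGeneratorPairing ν f u g) μ ∧
                ∫ u, Torus.nsGeneratorPairing ν f u g ∂μ = 0) ∧
          (Integrable (fun u : H3 => Torus.nsGeneratorPairing ν f u
              (Torus.fourierTruncate N ((u : L2T3) : T3 → R3))) μ ∧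
            ∫ u, Torus.nsGeneratorPairing ν f u
              (Torus.fourierTruncate N ((u : L2T3) : T3 → R3)) ∂μ = a) ∧
          (Integrable (fun u : H3 => Torus.nsGeneratorPairing ν f u
              (BDSV.curl (Torus.fourierTruncate N ((u : L2T3) : T3 → R3)))) μ ∧
            ∫ u, Torus.nsGeneratorPairing ν f u
              (BDSV.curl (Torus.fourierTruncate N ((u : L2T3) : T3 → R3))) ∂μ = b) ∧
          Torus.ensembleEnergy μ ≤ E ∧ 2 * ε ≤ Torus.ensembleDissipation ν μ :=
  Summit.AnomalousDissipation.AnomalousDissipation.Theorems.MomentParityCubicParityLoud.stub_balancedMenu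

/-! ## Glue (kernel-checked; no `sorry` outside the stubs) -/

/-- **Coefficient classification beyond a threshold**, glued from S3a (fed the proved engines
`localRank`, `isolationRank`) and S3b: for
`N ≥ N₁` every kernel whose form is a Casimir is `a·energy + b·helicity` on admissible families.
Pure logic: S3a (ii) rewrites the form to its diagonal part, S3a (i) feeds S3b with `D k := A k k`. [folklore] -/
theorem coefficientClassification_eventually :
    ∃ N₁ : ℕ, ∀ N : ℕ, N₁ ≤ N →
    (∀ A : ((Fin 3 → ℤ) → (Fin 3 → ℤ) → (EuclideanSpace ℂ (Fin 3) →ₗ[ℂ] EuclideanSpace ℂ (Fin 3))),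
        (∀ c : (Fin 3 → ℤ) → EuclideanSpace ℂ (Fin 3), (Torus.IsConjSymm c ∧ Torus.IsTransversal ((Torus.freqBall N).erase (0 : Fin 3 → ℤ)) c ∧
          ∀ k ∉ (Torus.freqBall N).erase (0 : Fin 3 → ℤ), c k = 0) →
          ∑ k ∈ ((Torus.freqBall N).erase (0 : Fin 3 → ℤ)), ∑ l ∈ ((Torus.freqBall N).erase (0 : Fin 3 → ℤ)),
            ((inner ℂ (Torus.leraySym k (Torus.convectionCoeff ((Torus.freqBall N).erase (0 : Fin 3 → ℤ)) c c k)) (A k l (c l))).re +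
              (inner ℂ (c k) (A k l (Torus.leraySym l (Torus.convectionCoeff ((Torus.freqBall N).erase (0 : Fin 3 → ℤ)) c c l)))).re) = 0) →
        ∃ a b : ℝ, ∀ c : (Fin 3 → ℤ) → EuclideanSpace ℂ (Fin 3), (Torus.IsConjSymm c ∧ Torus.IsTransversal ((Torus.freqBall N).erase (0 : Fin 3 → ℤ)) c ∧
          ∀ k ∉ (Torus.freqBall N).erase (0 : Fin 3 → ℤ), c k = 0) →
          (∑ k ∈ ((Torus.freqBall N).erase (0 : Fin 3 → ℤ)), ∑ l ∈ ((Torus.freqBall N).erase (0 : Fin 3 → ℤ)), (inner ℂ (c k) (A k l (c l))).re) =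
            a * (∑ k ∈ ((Torus.freqBall N).erase (0 : Fin 3 → ℤ)), ‖c k‖ ^ 2) + b * (∑ k ∈ ((Torus.freqBall N).erase (0 : Fin 3 → ℤ)), (inner ℂ (c k) (IntermittentBeltrami.curlCoeff c k)).re)) := by
  obtain ⟨N₁, hcov⟩ := covariantVanishing localRank isolationRank
  obtain ⟨N₂, hti⟩ := stub_diagonalClassification
  refine ⟨max N₁ N₂, fun N hN A hA => ?_⟩
  obtain ⟨hdiag, hform⟩ := hcov N (le_of_max_le_left hN) A hA
  obtain ⟨a, b, hab⟩ := hti N (le_of_max_le_right hN) (fun k => A k k) hdiag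
  exact ⟨a, b, fun c hc => by rw [hform c hc]; exact hab c hc⟩

/-- **QuadRigidity beyond a threshold** — the statement of the planner's monolithic `stub_quadRigidity`
(old S3), now PROVED from S3a/S3b (via `coefficientClassification_eventually`) and the bridge S3c: beyond
`N₁`, every homogeneous quadratic polynomial cylindrical observable with level-`N` band tests whose Euler
derivative vanishes at every level-`N` field has differential `2α P_N u + 2β curl P_N u` there.
(`IsBandTest`, `IsLevel`, `polyGrad` are the `Negative.Clauses` names of the unfolded clauses of S3c.) -/
theorem quadRigidity_eventually :
    ∃ N₁ : ℕ, ∀ N : ℕ, N₁ ≤ N →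
      ∀ (m : ℕ) (g : Fin m → T3 → R3) (P : MvPolynomial (Fin m) ℝ),
        (∀ i, IsBandTest N (g i)) → P.IsHomogeneous 2 →
        (∀ u : H3, IsLevel N u →
            Torus.nsGeneratorPairing (d := Fin 3) 0 0 u (polyGrad g P u) = 0) →
        ∃ α β : ℝ, ∀ u : H3, IsLevel N u → ∀ x : T3,
          polyGrad g P u x =
            (2 * α) • Torus.fourierTruncate N ((u : L2T3) : T3 → R3) x +
              (2 * β) • BDSV.curl (Torus.fourierTruncate N ((u : L2T3) : T3 → R3)) x := by
  obtain ⟨N₁, hN₁⟩ := coefficientClassification_eventually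
  refine ⟨N₁, fun N hN m g P hg hP hE => ?_⟩
  exact stub_coefficientBridge N (hN₁ N hN) m g P hg hP hE

/-- **`MomentParity.CubicParityLoud` from the stubs** (the lead's composition, unchanged). Given `f`, the menu (S5) supplies `(E, ε, ν₀, δ)` and,
for each `ν ∈ (0, ν₀)`, a threshold `N₀`; the classification (S3a/S3b/S3c, glued as
`quadRigidity_eventually`) supplies `N₁`. Answer the crux with `(E + 1, ε, ν₀)` and threshold `max N₀ N₁`.
At such `N`, by the conic duality (S1) it suffices to exclude weak certificates at `(E + 1, ε)`; a weak
certificate has a Casimir quadratic part (S2) and is then excluded by S4 fed with QuadRigidity at `N` and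
the menu at `(f, ν, N)`. Pure logic beyond the stubs; concludes the crux BY NAME through
`Negative.cubicParityLoud_iff` (`Iff.rfl`). -/
theorem momentParity_cubicParityLoud_of : CubicParityLoud := by
  rw [cubicParityLoud_iff]
  intro f hfs hfd hfz hf0
  obtain ⟨E, ε, ν₀, δ, hε, hν₀, hδ, hmenu⟩ := stub_balancedMenu f hfs hfd hfz hf0
  obtain ⟨N₁, hrig⟩ := quadRigidity_eventually
  refine ⟨E + 1, ε, ν₀, hε, hν₀, fun ν hν hνlt => ?_⟩
  obtain ⟨N₀, hN₀⟩ := hmenu ν hν hνlt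
  refine ⟨max N₀ N₁, fun N hN => ?_⟩
  have hN0 : N₀ ≤ N := le_trans (le_max_left _ _) hN
  have hN1 : N₁ ≤ N := le_trans (le_max_right _ _) hN
  refine stub_farkas f hfs ν N (E + 1) ε ?_
  rintro ⟨m, g, P, lb, lc, hg, hP, hlb, hlc, hnt, hineq⟩
  exact stub_noCasimirCertificate f hfs ν hν N E ε δ hε hδ (hrig N hN1) (hN₀ N hN0)
    m g P lb lc hg hP hlb hlc hnt hineq
    (stub_cubicCasimir f hfs ν N (E + 1) ε lb lc m g P hg hP hineq)

/-- **`QuarticLadder.CubicParityLoud` from the stubs** — the crux of THIS seat's route (rank-5 crux of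
route-AnomalousDissipation-QuarticLadder; the item stmt-AnomalousDissipation-11465 is shared and the two route decls are
verbatim twins, so the MomentParity composition transports by `Iff.rfl`). -/
theorem CubicParityLoud_of : Summit.AnomalousDissipation.AnomalousDissipation.Theses.QuarticLadder.CubicParityLoud :=
  momentParity_cubicParityLoud_of

end Summit.AnomalousDissipation.AnomalousDissipation.Cruxes.CubicParityLoud.RimSplitSweep

end
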